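import Mathlib
import Literature.Computability.AlgebraicComplexity.FermionicPencil
import Literature.Computability.AlgebraicComplexity.FermionantCompleteness
import Literature.Computability.AlgebraicComplexity.GenMatrixPoly
import Literature.Computability.AlgebraicComplexity.ValiantClassesProofs
import HarnessLib

/-!
# Proof of de Rugy-Altherre's Theorem 1 (`VP`-closure form): discharge of `DeRugyAltherre2013_thm1`

Sibling proof file of `Literature.Computability.AlgebraicComplexity.FermionantCompleteness`, which
STATES the named fact `DeRugyAltherre2013_thm1`: for a field `K` of characteristic zero and a
rational `t ∉ {0, 1}`, if the fermionic pencil family `Ferm^t_n = ∑_σ sgn σ · t^{c(σ)} ∏ᵢ X_{σ i, i}`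
is a `VP` family then so is the permanent family (N. de Rugy-Altherre, *Determinant versus
permanent: salvation via generalization?*, CiE 2013, LNCS 7921, arXiv:1309.2156, §3 Theorem 1).
This file proves `theorem DeRugyAltherre2013_thm1_holds : DeRugyAltherre2013_thm1`, sorry-free.

## The printed proof and the proof formalised here

Printed (arXiv pp. 3–4 and Appendix A): an *iff-gadget* (Fig. 2, appendix Lemma 4: three extra
vertices coupling two edges `e, e'` so that cycle covers using exactly one of them cancel in the
cycle-weighted sum, covers using both keep their weight, covers using neither are multiplied by a
nonzero constant), simultaneous gadgets (Lemma 5), `l` coupled copies of the graph making every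
cycle count `l` times (Lemma 2), a Vandermonde interpolation in `ω_l = (-k)^l` extracting the
cycle-format sums `c_m`, and `c_1 = HC_n` being `VNP`-complete (Bürgisser 2000, Cor. 3.19).

Formalised (same primitive, shorter road to the CONSEQUENCE form that is vendored): write
`cycW β M = ∑_σ β^{c(σ)} ∏ᵢ M i (σ i)` (so that `Ferm^t(M) = (-1)^N cycW (-t) M`,
`aeval_fermionicPencil_eq_cycW`).
* `cycW_option` — the **vertex elimination identity** (expanding a cover at one vertex: a loop,
  or a predecessor/successor pair whose contraction keeps the number of cycles), from
  `Equiv.Perm.decomposeOption` and two facts about `Equiv.Perm.numCycles` proved by counting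
  `SameCycle` classes (`numCycles_eq_numOrbits`, `numCycles_optionCongr`,
  `numCycles_swap_mul_optionCongr`).
* `cycW_gadget` — the **iff-gadget lemma** for a three-vertex gadget with internal matrix
  `[[1,1,1],[1,1,1],[-β,-β,1]]` (a variant of the printed one whose entries are polynomial in `β`;
  it needs exactly `β ∉ {0, -1}`, i.e. `t ∉ {0, 1}`), by three eliminations.
* `unroll_rowMajor` — unrolling a row-major family of private gadgets (the printed Lemma 5 in the
  form used here), abstractly.
* `cycW_MA` — **Stage A**, the printed Lemma 2 with `l = 2` copies: the coupled two-layer graph of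
  an `m × m` matrix `A` has `cycW β = (γ^{m-1} β)^m · cycW (β²) A`, `γ = -β²(β+1)`; this turns the
  cycle weight `-t` into `t² > 0`.
* `cycW_MB` — **Stage B**, replacing the Vandermonde interpolation and the appeal to `HC`: the
  averaging graph (`inl i → p_{ij}` with weight `X i j`, `p_{ij} → inr j`, `inr j → inl b` for all
  `b`) has `cycW β' = β'^{n(n-1)} K_n(β') · per X` with `K_n(β') = ∑_τ β'^{c(1 ⊕ τ-twist)}`, which is
  independent of the first factor by conjugation and POSITIVE for `β' = t² > 0` (`avgConst_pos`).
* Plumbing: `per_n = κ⁻¹ • φ(Ferm^t_{N(n)})` with `φ` a substitution of variables and constants,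
  `N(n) = 2(2n+n²) + 3(2n+n²)²` (`perPoly_eq_smul_aeval`), so `L(per_n) ≤ L(Ferm^t_{N(n)}) + 1`
  (`complexity_le_of_isProjection`, `complexity_smul_le_holds`), p-bounded by composition.

Everything except the final theorem lives in the sub-namespace
`Literature.Computability.AlgebraicComplexity.DeRugyAltherre` (grouping named after the paper).
No new named facts are introduced (D-0026); all intermediate results are proved here.

## References

* [DeRugyAltherre2013] N. de Rugy-Altherre, *Determinant versus permanent: salvation via
  generalization?*, CiE 2013, LNCS 7921, 87–96; arXiv:1309.2156: §2 (c-reductions), §3 Thm. 1,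
  Lemmas 1–2, Appendix A (iff-gadget, Lemmas 4–5).
* P. Bürgisser, *Completeness and Reduction in Algebraic Complexity Theory*, Springer 2000, §2.1,
  Rem. 2.7 (projections are free), §3 (iff-coupling).
-/

noncomputable section

open Equiv Equiv.Perm Finset

namespace Literature.Computability.AlgebraicComplexity

namespace DeRugyAltherre

universe u v

variable {α : Type u} {β : Type v} [Fintype α] [DecidableEq α] [Fintype β] [DecidableEq β]

/-! ### Orbit quotient of a permutation -/

/-- The set of cycles (= `SameCycle` classes, fixed points included) of a permutation, as a
quotient type. [folklore] -/
def OrbitQuot (σ : Perm α) : Type u := Quotient (SameCycle.setoid σ)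

/-- The orbit quotient of a permutation of a finite type is finite (decidable `SameCycle`). [folklore] -/
instance (σ : Perm α) : Fintype (OrbitQuot σ) :=
  @Quotient.fintype α _ (SameCycle.setoid σ) (fun x y => inferInstanceAs (Decidable (SameCycle σ x y)))

/-- The class of `x` in the orbit quotient. [folklore] -/
def orbitOf (σ : Perm α) (x : α) : OrbitQuot σ := Quotient.mk (SameCycle.setoid σ) x

omit [Fintype α] [DecidableEq α] in
/-- Two points have the same class iff they lie on the same cycle. [folklore] -/
theorem orbitOf_eq_orbitOf_iff (σ : Perm α) (x y : α) : orbitOf σ x = orbitOf σ y ↔ SameCycle σ x y :=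
  Quotient.eq (r := SameCycle.setoid σ)

omit [Fintype α] [DecidableEq α] in
/-- Every class is the class of a point. [folklore] -/
theorem orbitOf_surjective (σ : Perm α) : Function.Surjective (orbitOf σ) :=
  Quotient.mk_surjective

/-- The number of cycles of `σ`, fixed points included, counted as `SameCycle` classes. [folklore] -/
def numOrbits (σ : Perm α) : ℕ := Fintype.card (OrbitQuot σ)

omit [DecidableEq α] [Fintype β] [DecidableEq β] in
/-- Transfer of `SameCycle` along a map `φ` that takes each step of `f` into the `g`-class. [folklore] -/
theorem sameCycle_transfer {f : Perm α} {g : Perm β} (φ : α → β)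
    (hstep : ∀ z, SameCycle g (φ z) (φ (f z))) {x y : α} (h : SameCycle f x y) :
    SameCycle g (φ x) (φ y) := by
  obtain ⟨n, rfl⟩ := h.exists_nat_pow_eq
  clear h
  induction n generalizing x with
  | zero => simpa using SameCycle.rfl
  | succ n ih =>
    rw [pow_succ, Perm.mul_apply]
    exact (hstep x).trans (ih (x := f x))

/-- If `φ` maps `f`-steps into `g`-classes and every `g`-class meets the image of `φ`, then `g` has at
most as many cycles as `f`. [folklore] -/
theorem numOrbits_le_of_map {f : Perm α} {g : Perm β} (φ : α → β)
    (hstep : ∀ z, SameCycle g (φ z) (φ (f z))) (hsurj : ∀ b, ∃ x, SameCycle g b (φ x)) :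
    numOrbits g ≤ numOrbits f := by
  let F : OrbitQuot f → OrbitQuot g :=
    Quotient.lift (fun x => orbitOf g (φ x)) fun x y (h : SameCycle f x y) =>
      (orbitOf_eq_orbitOf_iff g _ _).2 (sameCycle_transfer φ hstep h)
  refine Fintype.card_le_of_surjective F fun q => ?_
  obtain ⟨b, rfl⟩ := orbitOf_surjective g q
  obtain ⟨x, hx⟩ := hsurj b
  exact ⟨orbitOf f x, ((orbitOf_eq_orbitOf_iff g _ _).2 hx).symm⟩

/-- Conjugating along an equivalence of types does not change the number of cycles. [folklore] -/
theorem numOrbits_permCongr (e : α ≃ β) (σ : Perm α) : numOrbits (e.permCongr σ) = numOrbits σ := by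
  apply le_antisymm
  · refine numOrbits_le_of_map e (fun z => ?_) (fun b => ⟨e.symm b, by simp [SameCycle.rfl]⟩)
    have : (e.permCongr σ) (e z) = e (σ z) := by simp
    rw [← this]
    exact (sameCycle_apply_right).2 SameCycle.rfl
  · refine numOrbits_le_of_map e.symm (fun z => ?_) (fun b => ⟨e b, by simp [SameCycle.rfl]⟩)
    have : σ (e.symm z) = e.symm ((e.permCongr σ) z) := by simp
    rw [← this]
    exact (sameCycle_apply_right).2 SameCycle.rfl

/-- The identity has one cycle per point. [folklore] -/
theorem numOrbits_one : numOrbits (1 : Perm α) = Fintype.card α := by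
  unfold numOrbits
  refine (Fintype.card_of_bijective (f := orbitOf (1 : Perm α)) ⟨fun x y h => ?_, orbitOf_surjective _⟩).symm
  simpa [orbitOf_eq_orbitOf_iff, sameCycle_one] using h

/-- Cycles of a sum of permutations. [folklore] -/
theorem numOrbits_sumCongr (σ : Perm α) (τ : Perm β) :
    numOrbits (σ.sumCongr τ) = numOrbits σ + numOrbits τ := by
  classical
  set S : Perm (α ⊕ β) := σ.sumCongr τ with hS
  have hpowl : ∀ (n : ℕ) (x : α), (S ^ n) (Sum.inl x) = Sum.inl ((σ ^ n) x) := by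
    intro n x
    induction n generalizing x with
    | zero => simp
    | succ n ih =>
      rw [pow_succ, Perm.mul_apply, pow_succ, Perm.mul_apply,
        show S (Sum.inl x) = Sum.inl (σ x) by simp [hS], ih]
  have hpowr : ∀ (n : ℕ) (y : β), (S ^ n) (Sum.inr y) = Sum.inr ((τ ^ n) y) := by
    intro n y
    induction n generalizing y with
    | zero => simp
    | succ n ih =>
      rw [pow_succ, Perm.mul_apply, pow_succ, Perm.mul_apply,
        show S (Sum.inr y) = Sum.inr (τ y) by simp [hS], ih]
  -- `F : OrbitQuot σ ⊕ OrbitQuot τ → OrbitQuot S` and `G` back, both surjective.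
  have hl : ∀ {x y : α}, SameCycle σ x y → SameCycle S (Sum.inl x) (Sum.inl y) := fun h =>
    sameCycle_transfer (g := S) Sum.inl (fun z => by
      have : S (Sum.inl z) = Sum.inl (σ z) := by simp [hS]
      rw [← this]; exact (sameCycle_apply_right).2 SameCycle.rfl) h
  have hr : ∀ {x y : β}, SameCycle τ x y → SameCycle S (Sum.inr x) (Sum.inr y) := fun h =>
    sameCycle_transfer (g := S) Sum.inr (fun z => by
      have : S (Sum.inr z) = Sum.inr (τ z) := by simp [hS]
      rw [← this]; exact (sameCycle_apply_right).2 SameCycle.rfl) h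
  have hl' : ∀ {x : α} {o : α ⊕ β}, SameCycle S (Sum.inl x) o → ∃ y, o = Sum.inl y ∧ SameCycle σ x y := by
    intro x o h
    obtain ⟨n, rfl⟩ := h.exists_nat_pow_eq
    exact ⟨(σ ^ n) x, hpowl n x, ⟨n, rfl⟩⟩
  have hr' : ∀ {x : β} {o : α ⊕ β}, SameCycle S (Sum.inr x) o → ∃ y, o = Sum.inr y ∧ SameCycle τ x y := by
    intro x o h
    obtain ⟨n, rfl⟩ := h.exists_nat_pow_eq
    exact ⟨(τ ^ n) x, hpowr n x, ⟨n, rfl⟩⟩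
  apply le_antisymm
  · -- surjection from the sum
    let F : OrbitQuot σ ⊕ OrbitQuot τ → OrbitQuot S :=
      Sum.elim
        (Quotient.lift (fun x => orbitOf S (Sum.inl x)) fun x y (h : SameCycle σ x y) =>
          (orbitOf_eq_orbitOf_iff _ _ _).2 (hl h))
        (Quotient.lift (fun x => orbitOf S (Sum.inr x)) fun x y (h : SameCycle τ x y) =>
          (orbitOf_eq_orbitOf_iff _ _ _).2 (hr h))
    have hF : Function.Surjective F := by
      intro q
      obtain ⟨o, rfl⟩ := orbitOf_surjective _ q
      rcases o with x | y
      · exact ⟨Sum.inl (orbitOf σ x), rfl⟩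
      · exact ⟨Sum.inr (orbitOf τ y), rfl⟩
    simpa [numOrbits, Fintype.card_sum] using Fintype.card_le_of_surjective F hF
  · let G : OrbitQuot S → OrbitQuot σ ⊕ OrbitQuot τ :=
      Quotient.lift (Sum.elim (fun x => Sum.inl (orbitOf σ x)) (fun y => Sum.inr (orbitOf τ y)))
        (by
          rintro (x | x) o (h : SameCycle S _ o)
          · obtain ⟨y, rfl, hy⟩ := hl' h
            simpa [orbitOf_eq_orbitOf_iff] using hy
          · obtain ⟨y, rfl, hy⟩ := hr' h
            simpa [orbitOf_eq_orbitOf_iff] using hy)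
    have hG : Function.Surjective G := by
      rintro (q | q)
      · obtain ⟨x, rfl⟩ := orbitOf_surjective _ q
        exact ⟨orbitOf S (Sum.inl x), rfl⟩
      · obtain ⟨y, rfl⟩ := orbitOf_surjective _ q
        exact ⟨orbitOf S (Sum.inr y), rfl⟩
    simpa [numOrbits, Fintype.card_sum] using Fintype.card_le_of_surjective G hG

/-- Adding a fixed point adds one cycle. [folklore] -/
theorem numOrbits_optionCongr (σ : Perm α) : numOrbits σ.optionCongr = numOrbits σ + 1 := by
  classical
  have h1 : numOrbits (σ.sumCongr (1 : Perm PUnit.{1})) = numOrbits σ + 1 := by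
    rw [numOrbits_sumCongr, numOrbits_one, Fintype.card_punit]
  rw [← h1]
  set e : Option α ≃ α ⊕ PUnit.{1} := Equiv.optionEquivSumPUnit.{0, u} α
  have key : ∀ z : Option α, e (σ.optionCongr z) = (σ.sumCongr (1 : Perm PUnit.{1})) (e z) := by
    rintro (_ | z) <;> rfl
  apply le_antisymm
  · refine numOrbits_le_of_map e.symm (fun z => ?_) (fun b => ⟨e b, by simp [SameCycle.rfl]⟩)
    have : σ.optionCongr (e.symm z) = e.symm ((σ.sumCongr (1 : Perm PUnit.{1})) z) := by
      apply e.injective; rw [key]; simp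
    rw [← this]
    exact (sameCycle_apply_right).2 SameCycle.rfl
  · refine numOrbits_le_of_map e (fun z => ?_) (fun b => ⟨e.symm b, by simp [SameCycle.rfl]⟩)
    rw [key]
    exact (sameCycle_apply_right).2 SameCycle.rfl

/-- Inserting a new point `none` into the cycle through `a` (the permutation
`swap none (some a) * optionCongr σ` sends `σ⁻¹ a ↦ none ↦ a`) does not change the number of
cycles. [folklore] -/
theorem numOrbits_swap_mul_optionCongr (σ : Perm α) (a : α) :
    numOrbits (swap none (some a) * σ.optionCongr) = numOrbits σ := by
  classical
  set S : Perm (Option α) := swap none (some a) * σ.optionCongr with hS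
  have hnone : S none = some a := by simp [hS]
  have hsome : ∀ z : α, S (some z) = if σ z = a then none else some (σ z) := by
    intro z
    simp only [hS, Perm.mul_apply, optionCongr_apply, Option.map_some]
    by_cases h : σ z = a
    · simp [h]
    · rw [if_neg h, swap_apply_of_ne_of_ne (by simp) (by simpa using h)]
  apply le_antisymm
  · -- classes of S ≤ classes of σ : use `some`
    refine numOrbits_le_of_map (f := σ) (g := S) some (fun z => ?_) (fun b => ?_)
    · by_cases h : σ z = a
      · have h2 : S (S (some z)) = some (σ z) := by rw [hsome, if_pos h, hnone, h]
        rw [← h2]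
        exact (sameCycle_apply_right.2 ((sameCycle_apply_right).2 SameCycle.rfl))
      · have h2 : S (some z) = some (σ z) := by rw [hsome, if_neg h]
        rw [← h2]
        exact (sameCycle_apply_right).2 SameCycle.rfl
    · rcases b with _ | x
      · exact ⟨a, by rw [← hnone]; exact (sameCycle_apply_right).2 SameCycle.rfl⟩
      · exact ⟨x, SameCycle.rfl⟩
  · -- classes of σ ≤ classes of S : use the projection `none ↦ a`
    refine numOrbits_le_of_map (f := S) (g := σ) (fun o => o.elim a id) (fun z => ?_)
      (fun b => ⟨some b, SameCycle.rfl⟩)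
    rcases z with _ | x
    · rw [hnone]; exact SameCycle.rfl
    · rw [hsome]
      by_cases h : σ x = a
      · rw [if_pos h]; simpa [h] using (sameCycle_apply_right (f := σ) (x := x) (y := x)).2 SameCycle.rfl
      · rw [if_neg h]; simpa using (sameCycle_apply_right (f := σ) (x := x) (y := x)).2 SameCycle.rfl

/-! ### The link with `Equiv.Perm.numCycles` -/

/-- `numCycles σ` (number of nontrivial cycle factors plus number of fixed points) is the number of
`SameCycle` classes. [folklore] -/
theorem numCycles_eq_numOrbits (σ : Perm α) : σ.numCycles = numOrbits σ := by
  classical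
  -- the comparison map to `cycleFactorsFinset σ ⊕ fixed points`
  let T := (σ.cycleFactorsFinset) ⊕ {x : α // σ x = x}
  have hT : Fintype.card T = σ.numCycles := by
    change Fintype.card (σ.cycleFactorsFinset ⊕ {x : α // σ x = x}) = _
    rw [Fintype.card_sum, Fintype.card_coe, Fintype.card_subtype, Equiv.Perm.numCycles_def,
      Equiv.Perm.cycleType_def, Multiset.card_map, Finset.card_val]
  rw [← hT]
  let G : OrbitQuot σ → T :=
    Quotient.lift
      (fun x => if h : σ x = x then Sum.inr ⟨x, h⟩ else
        Sum.inl ⟨σ.cycleOf x, cycleOf_mem_cycleFactorsFinset_iff.2 (mem_support.2 h)⟩)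
      (by
        intro x y (h : SameCycle σ x y)
        by_cases hx : σ x = x
        · have hxy : x = y := h.eq_of_left hx
          subst hxy
          rfl
        · have hy : ¬ σ y = y := fun hy => hx ((h.apply_eq_self_iff).2 hy)
          simp only [hx, hy, dif_neg, not_false_eq_true]
          exact congrArg Sum.inl (Subtype.ext h.cycleOf_eq))
  refine (Fintype.card_of_bijective (f := G) ⟨?_, ?_⟩).symm
  · intro p q hpq
    obtain ⟨x, rfl⟩ := orbitOf_surjective σ p
    obtain ⟨y, rfl⟩ := orbitOf_surjective σ q
    change (if h : σ x = x then _ else _ : T) = (if h : σ y = y then _ else _) at hpq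
    rw [orbitOf_eq_orbitOf_iff]
    by_cases hx : σ x = x <;> by_cases hy : σ y = y <;>
      simp only [hx, hy, dif_pos, dif_neg, not_false_eq_true] at hpq
    · have h' := Subtype.ext_iff.1 (Sum.inr_injective hpq)
      simp only at h'
      subst h'
      exact SameCycle.rfl
    · exact absurd hpq Sum.inr_ne_inl
    · exact absurd hpq Sum.inl_ne_inr
    · have h' := Subtype.ext_iff.1 (Sum.inl_injective hpq)
      exact (sameCycle_iff_cycleOf_eq_of_mem_support (mem_support.2 hx) (mem_support.2 hy)).2 h'
  · rintro (⟨c, hc⟩ | ⟨x, hx⟩)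
    · have hc' : c ∈ σ.cycleFactorsFinset := hc
      obtain ⟨a, ha⟩ := (mem_cycleFactorsFinset_iff.1 hc').1.nonempty_support
      have hσa : σ a ≠ a := mem_support.1 (mem_cycleFactorsFinset_support_le hc' ha)
      refine ⟨orbitOf σ a, ?_⟩
      change (if h : σ a = a then _ else _ : T) = _
      rw [dif_neg hσa]
      congr 1
      exact Subtype.ext (cycle_is_cycleOf ha hc').symm
    · refine ⟨orbitOf σ x, ?_⟩
      change (if h : σ x = x then _ else _ : T) = _
      rw [dif_pos hx]

/-! ### Consequences for `numCycles` -/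

/-- `numCycles` is invariant under conjugation along an equivalence of types. [folklore] -/
theorem numCycles_permCongr (e : α ≃ β) (σ : Perm α) : (e.permCongr σ).numCycles = σ.numCycles := by
  rw [numCycles_eq_numOrbits, numCycles_eq_numOrbits, numOrbits_permCongr]

/-- `numCycles` is additive on sums of permutations. [folklore] -/
theorem numCycles_sumCongr (σ : Perm α) (τ : Perm β) :
    (σ.sumCongr τ).numCycles = σ.numCycles + τ.numCycles := by
  simp only [numCycles_eq_numOrbits, numOrbits_sumCongr]

/-- Adding a fixed point adds one to `numCycles`. [folklore] -/
theorem numCycles_optionCongr (σ : Perm α) :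
    Equiv.Perm.numCycles (σ.optionCongr : Perm (Option α)) = σ.numCycles + 1 := by
  simp only [numCycles_eq_numOrbits, numOrbits_optionCongr]

/-- Inserting a new point into a cycle does not change `numCycles`. [folklore] -/
theorem numCycles_swap_mul_optionCongr (σ : Perm α) (a : α) :
    (swap none (some a) * σ.optionCongr).numCycles = σ.numCycles := by
  simp only [numCycles_eq_numOrbits, numOrbits_swap_mul_optionCongr]

/-- `numCycles` is invariant under inversion. [folklore] -/
theorem numCycles_inv (σ : Perm α) : σ⁻¹.numCycles = σ.numCycles := by
  simp only [Equiv.Perm.numCycles_def, Equiv.Perm.cycleType_inv]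
  congr 1
  refine Finset.card_bij (fun x _ => x) (fun x hx => ?_) (fun _ _ _ _ h => h) (fun y hy => ⟨y, ?_, rfl⟩)
  · simp only [Finset.mem_filter, Finset.mem_univ, true_and] at hx ⊢
    exact σ.inv_eq_iff_eq.mp hx |>.symm
  · simp only [Finset.mem_filter, Finset.mem_univ, true_and] at hy ⊢
    rw [Perm.inv_eq_iff_eq]; exact hy.symm


/-! ### The cycle-weighted cover sum of a square matrix and the vertex elimination identity -/

section CycW

variable {R : Type*} [CommRing R]
variable {V : Type*} [Fintype V] [DecidableEq V] {W : Type*} [Fintype W] [DecidableEq W]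

/-- The cycle-weighted cycle-cover sum ("`β`-permanent", row convention):
`cycW β M = ∑_σ β^{c(σ)} ∏ᵢ M i (σ i)`, `c(σ)` = number of cycles including fixed points.
For `β = 1` this is the permanent, for `β = -1` it is `(-1)^{card V}` times the determinant, and
`Ferm^t = (-1)^{card V} · cycW (-t)` (see `fermionicPencil_aeval_eq_cycW` below). [folklore] -/
def cycW (b : R) (M : Matrix V V R) : R :=
  ∑ σ : Perm V, b ^ σ.numCycles * ∏ i, M i (σ i)

omit [DecidableEq V] [DecidableEq W] in
/-- Reindexing a cover monomial along an equivalence. [folklore] -/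
theorem prod_comp_equiv_perm (e : W ≃ V) (M : Matrix V V R) (σ : Perm W) :
    ∏ i, M (e i) (e (σ i)) = ∏ j, M j ((e.permCongr σ) j) := by
  rw [← Fintype.prod_equiv e (fun i => M (e i) (e (σ i))) (fun j => M j ((e.permCongr σ) j))
    (fun i => by simp)]

/-- Reindexing rows and columns along an equivalence does not change `cycW`. [folklore] -/
theorem cycW_submatrix (b : R) (e : W ≃ V) (M : Matrix V V R) :
    cycW b (M.submatrix e e) = cycW b M := by
  unfold cycW
  refine Fintype.sum_equiv (e.permCongr) _ _ fun σ => ?_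
  rw [numCycles_permCongr]
  simp only [Matrix.submatrix_apply]
  rw [prod_comp_equiv_perm]

/-- A zero row kills `cycW`. [folklore] -/
theorem cycW_eq_zero_of_row_eq_zero (b : R) {M : Matrix V V R} (a : V) (h : ∀ j, M a j = 0) :
    cycW b M = 0 := by
  unfold cycW
  refine Finset.sum_eq_zero fun σ _ => ?_
  rw [Finset.prod_eq_zero (f := fun i => M i (σ i)) (Finset.mem_univ a) (h (σ a)), mul_zero]

/-- **Vertex elimination identity.** Expanding the cycle-weighted cover sum of a matrix on
`Option V` at the vertex `none`: either `none` is a fixed point (a loop, weight `β · N none none`),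
or it sits between a predecessor `a` and a successor `c` (possibly `a = c`), and contracting it
yields the covers of `V` using the edge `a → c`, i.e. of the matrix with row `a` replaced by the
unit vector at `c`; the number of cycles is unchanged by the contraction. [folklore] -/
theorem cycW_option (b : R) (N : Matrix (Option V) (Option V) R) :
    cycW b N = b * N none none * cycW b (N.submatrix some some) +
      ∑ a : V, ∑ c : V, N (some a) none * N none (some c) *
        cycW b ((N.submatrix some some).updateRow a (Pi.single c 1)) := by
  classical
  have hL : cycW b N = ∑ p : Option V × Perm V,
      b ^ (Equiv.Perm.decomposeOption.symm p).numCycles *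
        ∏ i, N i (Equiv.Perm.decomposeOption.symm p i) := by
    unfold cycW
    exact Fintype.sum_equiv Equiv.Perm.decomposeOption _ _ fun τ => by
      simp only [Equiv.symm_apply_apply]
  rw [hL, Fintype.sum_prod_type, Fintype.sum_option]
  congr 1
  · -- `none` is a fixed point
    unfold cycW
    rw [Finset.mul_sum]
    refine Finset.sum_congr rfl fun σ _ => ?_
    have hperm : Equiv.Perm.decomposeOption.symm (none, σ) = σ.optionCongr := by
      ext i : 1
      rw [Equiv.Perm.decomposeOption_symm_of_none_apply]
      rfl
    rw [hperm, numCycles_optionCongr, Fintype.prod_option]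
    simp only [Equiv.optionCongr_apply, Option.map_none, Option.map_some, Matrix.submatrix_apply,
      pow_succ]
    ring
  · -- `none` lies on a cycle through `V`
    unfold cycW
    simp_rw [Finset.mul_sum]
    have key : ∀ σ : Perm V,
        (∑ a : V, b ^ (Equiv.Perm.decomposeOption.symm (some a, σ)).numCycles *
          ∏ i, N i (Equiv.Perm.decomposeOption.symm (some a, σ) i)) =
        ∑ a : V, ∑ c : V, N (some a) none * N none (some c) *
          (b ^ σ.numCycles * ∏ i, ((N.submatrix some some).updateRow a (Pi.single c 1)) i (σ i)) := by
      intro σ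
      -- reindex the predecessor: `a = σ a'`
      rw [← Fintype.sum_equiv σ
        (fun a' => b ^ (Equiv.Perm.decomposeOption.symm (some (σ a'), σ)).numCycles *
          ∏ i, N i (Equiv.Perm.decomposeOption.symm (some (σ a'), σ) i)) _ (fun a' => rfl)]
      refine Finset.sum_congr rfl fun a' _ => ?_
      rw [Finset.sum_eq_single (σ a')]
      · have hd : Equiv.Perm.decomposeOption.symm (some (σ a'), σ) =
            swap none (some (σ a')) * σ.optionCongr := rfl
        rw [hd, numCycles_swap_mul_optionCongr, Fintype.prod_option]
        have h1 : (swap none (some (σ a')) * σ.optionCongr) none = some (σ a') := by simp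
        have h2 : ∀ y : V, N (some y) ((swap none (some (σ a')) * σ.optionCongr) (some y)) =
            Function.update (fun y => N (some y) (some (σ y))) a' (N (some a') none) y := by
          intro y
          by_cases hy : y = a'
          · subst hy
            simp
          · have hne : σ y ≠ σ a' := fun h => hy (σ.injective h)
            rw [Function.update_of_ne hy, Perm.mul_apply, Equiv.optionCongr_apply, Option.map_some,
              swap_apply_of_ne_of_ne (by simp) (by simpa using hne)]
        have h3 : ∀ y : V, ((N.submatrix some some).updateRow a' (Pi.single (σ a') 1)) y (σ y) =
            Function.update (fun y => N (some y) (some (σ y))) a' 1 y := by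
          intro y
          by_cases hy : y = a'
          · subst hy
            simp
          · rw [Function.update_of_ne hy, Matrix.updateRow_ne hy, Matrix.submatrix_apply]
        rw [h1, Finset.prod_congr rfl (fun y _ => h2 y), Finset.prod_congr rfl (fun y _ => h3 y),
          Finset.prod_update_of_mem (Finset.mem_univ a'),
          Finset.prod_update_of_mem (Finset.mem_univ a')]
        ring
      · intro c _ hc
        rw [Finset.prod_eq_zero (Finset.mem_univ a'), mul_zero, mul_zero]
        rw [Matrix.updateRow_self, Pi.single_apply, if_neg (Ne.symm hc)]
      · simp
    calc _ = _ := Finset.sum_comm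
      _ = _ := Finset.sum_congr rfl fun σ _ => key σ
      _ = _ := Finset.sum_comm
      _ = _ := Finset.sum_congr rfl fun a _ => Finset.sum_comm

end CycW


/-! ### Attaching one vertex, and the iff-gadget -/

section Gadget

variable {R : Type*} [CommRing R]
variable {V : Type*} [Fintype V] [DecidableEq V]

/-- Attach one new vertex `none` to a weighted digraph `N` on `V`: `col a` is the weight of the
edge `a → none`, `row c` the weight of `none → c`, `d` the weight of the loop at `none`. [folklore] -/
def att1 (N : Matrix V V R) (col row : V → R) (d : R) : Matrix (Option V) (Option V) R := fun i j =>
  match i, j with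
  | some i, some j => N i j
  | some i, none => col i
  | none, some j => row j
  | none, none => d

omit [CommRing R] [Fintype V] [DecidableEq V] in
/-- Entries of `att1`: old block. [folklore] -/
@[simp] theorem att1_some_some (N : Matrix V V R) (col row : V → R) (d : R) (i j : V) :
    att1 N col row d (some i) (some j) = N i j := rfl

omit [CommRing R] [Fintype V] [DecidableEq V] in
/-- Entries of `att1`: column of the new vertex. [folklore] -/
@[simp] theorem att1_some_none (N : Matrix V V R) (col row : V → R) (d : R) (i : V) :
    att1 N col row d (some i) none = col i := rfl

omit [CommRing R] [Fintype V] [DecidableEq V] in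
/-- Entries of `att1`: row of the new vertex. [folklore] -/
@[simp] theorem att1_none_some (N : Matrix V V R) (col row : V → R) (d : R) (j : V) :
    att1 N col row d none (some j) = row j := rfl

omit [CommRing R] [Fintype V] [DecidableEq V] in
/-- Entries of `att1`: loop at the new vertex. [folklore] -/
@[simp] theorem att1_none_none (N : Matrix V V R) (col row : V → R) (d : R) :
    att1 N col row d none none = d := rfl

/-- The elimination identity for an attached vertex. [folklore] -/
theorem cycW_att1 (b : R) (N : Matrix V V R) (col row : V → R) (d : R) :
    cycW b (att1 N col row d) =
      b * d * cycW b N + ∑ a, ∑ c, col a * row c * cycW b (N.updateRow a (Pi.single c 1)) := by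
  rw [cycW_option]
  rfl

omit [Fintype V] in
/-- Normal form: forcing the new vertex to loop. [folklore] -/
@[simp] theorem att1_updateRow_none_single_none (N : Matrix V V R) (col row : V → R) (d x : R) :
    (att1 N col row d).updateRow none (Pi.single none x) = att1 N col 0 x := by
  ext i j
  cases i <;> cases j <;> simp [Matrix.updateRow_apply]

omit [Fintype V] in
/-- Normal form: zeroing the row of the new vertex. [folklore] -/
@[simp] theorem att1_updateRow_none_zero (N : Matrix V V R) (col row : V → R) (d : R) :
    (att1 N col row d).updateRow none 0 = att1 N col 0 0 := by
  ext i j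
  cases i <;> cases j <;> simp [Matrix.updateRow_apply]

omit [Fintype V] in
/-- Normal form: forcing the new vertex to exit to `c`. [folklore] -/
@[simp] theorem att1_updateRow_none_single_some (N : Matrix V V R) (col row : V → R) (d x : R)
    (c : V) : (att1 N col row d).updateRow none (Pi.single (some c) x) = att1 N col (Pi.single c x) 0 := by
  ext i j
  cases i <;> cases j <;> simp [Matrix.updateRow_apply, Pi.single_apply]

omit [Fintype V] in
/-- Normal form: forcing an old vertex to enter the new vertex. [folklore] -/
@[simp] theorem att1_updateRow_some_single_none (N : Matrix V V R) (col row : V → R) (d x : R)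
    (a : V) : (att1 N col row d).updateRow (some a) (Pi.single none x) =
      att1 (N.updateRow a 0) (Function.update col a x) row d := by
  ext i j
  cases i <;> cases j <;> simp [Matrix.updateRow_apply, Function.update_apply]

omit [Fintype V] in
/-- Normal form: forcing an old vertex onto an old vertex. [folklore] -/
@[simp] theorem att1_updateRow_some_single_some (N : Matrix V V R) (col row : V → R) (d x : R)
    (a c : V) : (att1 N col row d).updateRow (some a) (Pi.single (some c) x) =
      att1 (N.updateRow a (Pi.single c x)) (Function.update col a 0) row d := by
  ext i j
  cases i <;> cases j <;> simp [Matrix.updateRow_apply, Pi.single_apply, Function.update_apply]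

omit [CommRing R] [Fintype V] in
/-- Updating an `Option.elim` column at `none`. [folklore] -/
theorem update_option_elim (x w : R) (f : V → R) :
    Function.update (fun o : Option V => o.elim x f) none w = fun o => o.elim w f := by
  ext o; cases o <;> simp

omit [CommRing R] [Fintype V] in
/-- Updating the same row twice. [folklore] -/
theorem updateRow_updateRow_same (N : Matrix V V R) (a : V) (w w' : V → R) :
    (N.updateRow a w).updateRow a w' = N.updateRow a w' :=
  Function.update_idem _ _ _

/-- A zeroed row kills `cycW`. [folklore] -/
@[simp] theorem cycW_updateRow_zero (b : R) (N : Matrix V V R) (a : V) :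
    cycW b (N.updateRow a 0) = 0 :=
  cycW_eq_zero_of_row_eq_zero b a fun j => by simp

/-- A zeroed row kills `cycW` even after updating another row. [folklore] -/
theorem cycW_updateRow_zero_updateRow (b : R) (N : Matrix V V R) {a a' : V} (h : a' ≠ a)
    (w : V → R) : cycW b ((N.updateRow a 0).updateRow a' w) = 0 :=
  cycW_eq_zero_of_row_eq_zero b a fun j => by
    rw [Matrix.updateRow_ne (Ne.symm h), Matrix.updateRow_self]; rfl

/-- Collapsing a sum against a unit vector (left factor). [folklore] -/
theorem sum_single_mul_mul (u : V) (q r : R) (X : V → R) :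
    ∑ i, (Pi.single u q : V → R) i * r * X i = q * r * X u := by
  rw [Finset.sum_eq_single u (fun i _ hi => by simp [hi]) (by simp)]
  simp

/-- Collapsing a sum against a unit vector (middle factor). [folklore] -/
theorem sum_mul_single_mul (v : V) (c q : R) (X : V → R) :
    ∑ j, c * (Pi.single v q : V → R) j * X j = c * q * X v := by
  rw [Finset.sum_eq_single v (fun j _ hj => by simp [hj]) (by simp)]
  simp

/-- Collapsing a double sum against two unit vectors. [folklore] -/
theorem sum_sum_single_single (u v : V) (q q' : R) (X : V → V → R) :
    ∑ i, ∑ j, (Pi.single u q : V → R) i * (Pi.single v q' : V → R) j * X i j = q * q' * X u v := by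
  rw [Finset.sum_eq_single u (fun i _ hi => by simp [hi]) (by simp)]
  rw [Finset.sum_eq_single v (fun j _ hj => by simp [hj]) (by simp)]
  simp

/-- Collapsing a sum against a two-entry column. [folklore] -/
theorem sum_update_single_mul_mul {u u' : V} (hu : u ≠ u') (q w r : R) (X : V → R) :
    ∑ i, Function.update (Pi.single u q : V → R) u' w i * r * X i = w * r * X u' + q * r * X u := by
  rw [Fintype.sum_eq_add u' u (Ne.symm hu)]
  · simp [hu]
  · rintro x ⟨h1, h2⟩
    simp [h1, h2]

/-- Collapsing a double sum against a two-entry column and a unit row. [folklore] -/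
theorem sum_sum_update_single_single {u u' : V} (hu : u ≠ u') (v : V) (q w q' : R)
    (X : V → V → R) :
    ∑ i, ∑ j, Function.update (Pi.single u q : V → R) u' w i * (Pi.single v q' : V → R) j * X i j =
      w * q' * X u' v + q * q' * X u v := by
  rw [Fintype.sum_eq_add u' u (Ne.symm hu)]
  · rw [Finset.sum_eq_single v (fun j _ hj => by simp [hj]) (by simp)]
    rw [Finset.sum_eq_single v (fun j _ hj => by simp [hj]) (by simp)]
    simp [hu]
  · rintro x ⟨h1, h2⟩
    simp [h1, h2]

/-- Level-1 expansion: unit column and row. [folklore] -/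
theorem cycW_att1_single_single (b : R) (N : Matrix V V R) (u v : V) (y x d : R) :
    cycW b (att1 N (Pi.single u y) (Pi.single v x) d) =
      b * d * cycW b N + y * x * cycW b (N.updateRow u (Pi.single v 1)) := by
  rw [cycW_att1, sum_sum_single_single]

/-- Level-1 expansion: zero row. [folklore] -/
theorem cycW_att1_row_zero (b : R) (N : Matrix V V R) (col : V → R) (d : R) :
    cycW b (att1 N col 0 d) = b * d * cycW b N := by
  rw [cycW_att1]
  simp

/-- Level-1 expansion: column with two entries. [folklore] -/
theorem cycW_att1_update_single (b : R) (N : Matrix V V R) {u u' : V} (hu : u ≠ u') (v : V)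
    (y w x d : R) :
    cycW b (att1 N (Function.update (Pi.single u y) u' w) (Pi.single v x) d) =
      b * d * cycW b N + w * x * cycW b (N.updateRow u' (Pi.single v 1)) +
        y * x * cycW b (N.updateRow u (Pi.single v 1)) := by
  rw [cycW_att1, sum_sum_update_single_single hu]
  ring

/-- Level-2 expansion: column and row each `= const` on the new vertex below plus a unit vector. [folklore] -/
theorem cycW_att1_elim_elim (b : R) (G : Matrix (Option V) (Option V) R) (u' v' : V)
    (p q p' q' d : R) :
    cycW b (att1 G (fun o => o.elim p (Pi.single u' q)) (fun o => o.elim p' (Pi.single v' q')) d) =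
      b * d * cycW b G + p * p' * cycW b (G.updateRow none (Pi.single none 1)) +
        p * q' * cycW b (G.updateRow none (Pi.single (some v') 1)) +
        q * p' * cycW b (G.updateRow (some u') (Pi.single none 1)) +
        q * q' * cycW b (G.updateRow (some u') (Pi.single (some v') 1)) := by
  rw [cycW_att1]
  simp only [Fintype.sum_option, Option.elim_none, Option.elim_some, Finset.sum_add_distrib,
    sum_single_mul_mul, sum_mul_single_mul]
  ring

/-- Level-2 expansion: row a unit vector at the vertex below. [folklore] -/
theorem cycW_att1_elim_single_none (b : R) (G : Matrix (Option V) (Option V) R) (u' : V)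
    (p q x d : R) :
    cycW b (att1 G (fun o => o.elim p (Pi.single u' q)) (Pi.single none x) d) =
      b * d * cycW b G + p * x * cycW b (G.updateRow none (Pi.single none 1)) +
        q * x * cycW b (G.updateRow (some u') (Pi.single none 1)) := by
  rw [cycW_att1]
  simp only [Fintype.sum_option, Option.elim_none, Option.elim_some,
    sum_single_mul_mul, Pi.single_eq_same, Pi.single_eq_of_ne (Option.some_ne_none _), mul_zero,
    zero_mul, Finset.sum_const_zero, add_zero]
  ring

/-- Level-3 expansion for the gadget's top vertex. [folklore] -/
theorem cycW_att1_top (b : R) (G : Matrix (Option (Option V)) (Option (Option V)) R) (p d : R) :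
    cycW b (att1 G (fun o => o.elim 1 fun o' => o'.elim 1 0) (fun o => o.elim p fun o' => o'.elim p 0) d) =
      b * d * cycW b G + p * (cycW b (G.updateRow none (Pi.single none 1)) +
        cycW b (G.updateRow none (Pi.single (some none) 1)) +
        cycW b (G.updateRow (some none) (Pi.single none 1)) +
        cycW b (G.updateRow (some none) (Pi.single (some none) 1))) := by
  rw [cycW_att1]
  simp only [Fintype.sum_option, Option.elim_none, Option.elim_some, Pi.zero_apply, mul_zero,
    zero_mul, Finset.sum_const_zero, add_zero]
  ring

/-- The three-vertex iff-gadget coupling the edge `u → v` (weight `y`) with the edge `u' → v'`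
(weight `y'`): vertices `p₁ = some (some none)`, `p₂ = some none`, `p₃ = none`; edges
`u → p₁` (`y`), `p₁ → v` (`1`), `u' → p₂` (`y'`), `p₂ → v'` (`1`), and the internal matrix
`Γ = [[1,1,1],[1,1,1],[-β,-β,1]]` on `(p₁, p₂, p₃)`. A variant (with entries polynomial in `β`) of
Bürgisser's iff-coupling and of de Rugy-Altherre's fermionant iff-gadget
(de Rugy-Altherre 2013, Fig. 2 and appendix Lemma 4). [cite: DeRugyAltherre2013, §3 Lemma 1 and Appendix A] -/
def gadget (N : Matrix V V R) (u u' v v' : V) (y y' b : R) :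
    Matrix (Option (Option (Option V))) (Option (Option (Option V))) R :=
  att1
    (att1 (att1 N (Pi.single u y) (Pi.single v 1) 1)
      (fun o => o.elim 1 (Pi.single u' y')) (fun o => o.elim 1 (Pi.single v' 1)) 1)
    (fun o => o.elim 1 fun o' => o'.elim 1 0) (fun o => o.elim (-b) fun o' => o'.elim (-b) 0) 1

/-- **The iff-gadget lemma** (de Rugy-Altherre 2013, Lemma 1 / appendix Lemma 4, for the present
gadget): the covers of the gadget graph contribute `-β²(β+1)` times the covers of `N` using
neither of the two coupled edges, plus `β · y · y'` times the covers using both; covers using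
exactly one of them cancel. [cite: DeRugyAltherre2013, §3 Lemma 1 and Appendix A] -/
theorem cycW_gadget (b : R) (N : Matrix V V R) {u u' : V} (hu : u ≠ u') (v v' : V) (y y' : R) :
    cycW b (gadget N u u' v v' y y' b) =
      -(b ^ 2 * (b + 1)) * cycW b N +
        b * y * y' * cycW b ((N.updateRow u' (Pi.single v' 1)).updateRow u (Pi.single v 1)) := by
  rw [gadget, cycW_att1_top]
  simp only [att1_updateRow_none_single_none, att1_updateRow_none_single_some,
    att1_updateRow_some_single_none, att1_updateRow_some_single_some, att1_updateRow_none_zero,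
    update_option_elim]
  simp only [cycW_att1_elim_elim, cycW_att1_elim_single_none, cycW_att1_row_zero,
    att1_updateRow_none_single_none, att1_updateRow_none_single_some,
    att1_updateRow_some_single_none, att1_updateRow_some_single_some]
  simp only [cycW_att1_single_single, cycW_att1_update_single _ _ hu,
    cycW_updateRow_zero, cycW_updateRow_zero_updateRow _ _ hu, updateRow_updateRow_same]
  ring

end Gadget


/-! ### Abstract unrolling of a row-major gadget elimination -/

section Unroll

variable {R : Type*} [CommRing R] {m : ℕ}

/-- Commitment state with rows `≥ i` committed according to `g` and rows `< i` free. [folklore] -/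
def cg (i : ℕ) (g : Fin m → Fin m) : Fin m → Option (Fin m) :=
  fun r => if i ≤ (r : ℕ) then some (g r) else none

/-- All rows committed. [folklore] -/
theorem cg_zero (g : Fin m → Fin m) : cg 0 g = fun r => some (g r) := by
  funext r; simp [cg]

/-- All rows free. [folklore] -/
theorem cg_self (g : Fin m → Fin m) : cg m g = fun _ => none := by
  funext r; simp [cg, Nat.not_le.2 r.isLt]

/-- Row `i` is free in `cg (i+1) g`. [folklore] -/
theorem cg_succ_apply_self {i : ℕ} (hi : i < m) (g : Fin m → Fin m) : cg (i + 1) g ⟨i, hi⟩ = none := by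
  simp [cg]

/-- Committing row `i` in `cg (i+1) g` gives `cg i`. [folklore] -/
theorem update_cg_succ {i : ℕ} (hi : i < m) (g : Fin m → Fin m) (j : Fin m) :
    Function.update (cg (i + 1) g) ⟨i, hi⟩ (some j) = cg i (Function.update g ⟨i, hi⟩ j) := by
  funext r
  by_cases hr : r = ⟨i, hi⟩
  · subst hr
    simp [cg]
  · have hne : (r : ℕ) ≠ i := fun h => hr (Fin.ext h)
    rw [Function.update_of_ne hr]
    simp only [cg, Function.update_of_ne hr]
    have : (i + 1 ≤ (r : ℕ)) ↔ (i ≤ (r : ℕ)) := by omega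
    simp only [this]

/-- **Abstract unrolling lemma.** A quantity `Ψ k c` attached to `k` remaining row-major private
gadgets and a commitment state `c`, which obeys the one-gadget recursion
`Ψ (im+j+1) c = γ Ψ (im+j) c + δ [c i free] A i j Ψ (im+j) (c[i ↦ j])` and vanishes when a free row
has no gadget left, unrolls to `(γ^{m-1} δ)^m ∑_h (∏ A r (h r)) Ψ 0 h`. [folklore] -/
theorem unroll_rowMajor (γ δ : R) (A : Fin m → Fin m → R) (Ψ : ℕ → (Fin m → Option (Fin m)) → R)
    (hrec : ∀ (i j : Fin m) (c : Fin m → Option (Fin m)),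
      Ψ ((i : ℕ) * m + j + 1) c = γ * Ψ ((i : ℕ) * m + j) c +
        δ * (if c i = none then A i j * Ψ ((i : ℕ) * m + j) (Function.update c i (some j)) else 0))
    (hzero : ∀ (i : Fin m) (c : Fin m → Option (Fin m)), c i = none → ∀ k, k ≤ (i : ℕ) * m → Ψ k c = 0) :
    Ψ (m * m) (fun _ => none) =
      (γ ^ (m - 1) * δ) ^ m * ∑ h : Fin m → Fin m, (∏ r, A r (h r)) * Ψ 0 (fun r => some (h r)) := by
  -- inert gadgets of a committed row
  have inert : ∀ (i : Fin m) (c : Fin m → Option (Fin m)), c i ≠ none →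
      ∀ j : ℕ, j ≤ m → Ψ ((i : ℕ) * m + j) c = γ ^ j * Ψ ((i : ℕ) * m) c := by
    intro i c hc j hj
    induction j with
    | zero => simp
    | succ j ih =>
      have hjm : j < m := hj
      have := hrec i ⟨j, hjm⟩ c
      simp only [hc, if_false, mul_zero, add_zero] at this
      rw [← add_assoc, this, ih hjm.le, pow_succ]
      ring
  -- peeling the gadgets of a free row
  have peel : ∀ (i : Fin m) (c : Fin m → Option (Fin m)), c i = none →
      ∀ j : ℕ, j + 1 ≤ m → Ψ ((i : ℕ) * m + (j + 1)) c = γ ^ (j + 1) * Ψ ((i : ℕ) * m) c +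
        δ * γ ^ j * ∑ j' : Fin m,
          (if (j' : ℕ) ≤ j then A i j' * Ψ ((i : ℕ) * m) (Function.update c i (some j')) else 0) := by
    intro i c hc j hj
    induction j with
    | zero =>
      have h0 : 0 < m := hj
      have := hrec i ⟨0, h0⟩ c
      simp only [hc, if_true, Nat.add_zero] at this
      rw [zero_add, this, Finset.sum_eq_single (⟨0, h0⟩ : Fin m)]
      · simp
      · intro j' _ hj'
        have : ¬ ((j' : ℕ) ≤ 0) := fun h => hj' (Fin.ext (Nat.le_zero.1 h))
        simp [this]
      · simp
    | succ j ih =>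
      have hjm : j + 1 < m := hj
      have hr := hrec i ⟨j + 1, hjm⟩ c
      simp only [hc, if_true] at hr
      rw [show (i : ℕ) * m + (j + 1 + 1) = (i : ℕ) * m + ↑(⟨j + 1, hjm⟩ : Fin m) + 1 from by simp; ring,
        hr, show (i : ℕ) * m + ↑(⟨j + 1, hjm⟩ : Fin m) = (i : ℕ) * m + (j + 1) from rfl,
        ih (by omega), inert i _ (by simp) (j + 1) (by omega)]
      -- compare the sums
      have hsplit : ∀ j' : Fin m,
          (if (j' : ℕ) ≤ j + 1 then A i j' * Ψ ((i : ℕ) * m) (Function.update c i (some j')) else 0) =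
          (if (j' : ℕ) ≤ j then A i j' * Ψ ((i : ℕ) * m) (Function.update c i (some j')) else 0) +
          (if j' = ⟨j + 1, hjm⟩ then A i j' * Ψ ((i : ℕ) * m) (Function.update c i (some j')) else 0) := by
        intro j'
        by_cases h1 : (j' : ℕ) ≤ j
        · have h2 : j' ≠ ⟨j + 1, hjm⟩ := fun h => by subst h; simp at h1
          have h3 : (j' : ℕ) ≤ j + 1 := by omega
          simp [h1, h2, h3]
        · by_cases h2 : j' = ⟨j + 1, hjm⟩
          · subst h2; simp
          · have h3 : ¬ (j' : ℕ) ≤ j + 1 := fun h => by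
              rcases Nat.lt_or_eq_of_le h with h | h
              · exact h1 (Nat.lt_succ_iff.1 h)
              · exact h2 (Fin.ext h)
            simp [h1, h2, h3]
      simp only [hsplit, Finset.sum_add_distrib, Finset.sum_ite_eq', Finset.mem_univ, if_true]
      ring
  have rowPeel : ∀ (i : Fin m) (c : Fin m → Option (Fin m)), c i = none →
      Ψ ((i : ℕ) * m + m) c =
        γ ^ (m - 1) * δ * ∑ j : Fin m, A i j * Ψ ((i : ℕ) * m) (Function.update c i (some j)) := by
    intro i c hc
    have hm : 0 < m := i.pos
    obtain ⟨m', hm'⟩ : ∃ m', m = m' + 1 := ⟨m - 1, by omega⟩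
    have := peel i c hc m' (by omega)
    rw [← hm'] at this
    rw [this, hzero i c hc _ le_rfl, mul_zero, zero_add]
    have hsub : m - 1 = m' := by omega
    rw [hsub]
    congr 1
    · ring
    · refine Finset.sum_congr rfl fun j' _ => ?_
      have : (j' : ℕ) ≤ m' := by have := j'.isLt; omega
      simp [this]
  -- unrolling row by row
  have unroll : ∀ i : ℕ, i ≤ m → ∀ g : Fin m → Fin m,
      Ψ (i * m) (cg i g) = (γ ^ (m - 1) * δ) ^ i *
        ∑ h : Fin m → Fin m, (if ∀ r : Fin m, i ≤ (r : ℕ) → h r = g r then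
          (∏ r : Fin m, if (r : ℕ) < i then A r (h r) else 1) * Ψ 0 (fun r => some (h r)) else 0) := by
    intro i hi
    induction i with
    | zero =>
      intro g
      have hind : ∀ h : Fin m → Fin m, (∀ r : Fin m, 0 ≤ (r : ℕ) → h r = g r) ↔ h = g := fun h =>
        ⟨fun H => funext fun r => H r (Nat.zero_le _), fun H r _ => by rw [H]⟩
      simp only [zero_mul, cg_zero, pow_zero, one_mul, Nat.not_lt_zero, if_false,
        Finset.prod_const_one, hind, Finset.sum_ite_eq', Finset.mem_univ, if_true]
    | succ i ih =>
      intro g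
      have him : i < m := hi
      have hfree : cg (i + 1) g ⟨i, him⟩ = none := cg_succ_apply_self him g
      rw [Nat.succ_mul, rowPeel ⟨i, him⟩ _ hfree]
      simp only [update_cg_succ him, ih him.le, Finset.mul_sum]
      rw [Finset.sum_comm, pow_succ]
      refine Finset.sum_congr rfl fun h _ => ?_
      -- collapse the sum over `j`
      have hP : ∀ j : Fin m, (∀ r : Fin m, i ≤ (r : ℕ) → h r = Function.update g ⟨i, him⟩ j r) ↔
          (h ⟨i, him⟩ = j ∧ ∀ r : Fin m, i + 1 ≤ (r : ℕ) → h r = g r) := by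
        intro j
        constructor
        · intro H
          refine ⟨by simpa using H ⟨i, him⟩ le_rfl, fun r hr => ?_⟩
          have hne : r ≠ ⟨i, him⟩ := fun h => by subst h; simp at hr
          simpa [Function.update_of_ne hne] using H r (by omega)
        · rintro ⟨h1, h2⟩ r hr
          by_cases hre : r = ⟨i, him⟩
          · subst hre; simpa using h1
          · have : (r : ℕ) ≠ i := fun h => hre (Fin.ext (by simpa using h))
            rw [Function.update_of_ne hre]
            exact h2 r (by omega)
      have hprod : (∏ r : Fin m, if (r : ℕ) < i + 1 then A r (h r) else 1) =
          A ⟨i, him⟩ (h ⟨i, him⟩) * ∏ r : Fin m, if (r : ℕ) < i then A r (h r) else 1 := by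
        rw [← Finset.mul_prod_erase Finset.univ (fun r : Fin m => if (r : ℕ) < i + 1 then A r (h r) else 1)
            (Finset.mem_univ ⟨i, him⟩),
          ← Finset.mul_prod_erase Finset.univ (fun r : Fin m => if (r : ℕ) < i then A r (h r) else 1)
            (Finset.mem_univ ⟨i, him⟩)]
        simp only [Nat.lt_add_one, lt_self_iff_false, if_true, if_false, one_mul]
        congr 1
        refine Finset.prod_congr rfl fun r hr => ?_
        have hne : (r : ℕ) ≠ i := fun h => (Finset.mem_erase.1 hr).1 (Fin.ext (by simpa using h))
        have : ((r : ℕ) < i + 1) ↔ ((r : ℕ) < i) := by omega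
        simp only [this]
      simp only [hP, ite_and, mul_ite, mul_zero, Finset.sum_ite_eq, Finset.mem_univ, if_true]
      by_cases hQ : ∀ r : Fin m, i + 1 ≤ (r : ℕ) → h r = g r
      · rw [if_pos hQ, if_pos hQ, hprod]; ring
      · rw [if_neg hQ, if_neg hQ]
  have := unroll m le_rfl id
  rw [cg_self] at this
  rw [this]
  congr 1
  refine Finset.sum_congr rfl fun h _ => ?_
  simp [Nat.not_le.2 (Fin.isLt _)]

end Unroll


/-! ### Stage A: two coupled layers (de Rugy-Altherre 2013, Lemma 2 with `l = 2`) -/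

section StageA

variable {R : Type*} [CommRing R]

section GadgetAPI

variable {V : Type*} [Fintype V] [DecidableEq V]

omit [CommRing R] [Fintype V] in
/-- Updating an `Option.elim` column at an old vertex. [folklore] -/
theorem update_option_elim_some (x : V) (p w : R) (f : V → R) :
    Function.update (fun o : Option V => o.elim p f) (some x) w = fun o => o.elim p (Function.update f x w) := by
  ext o; cases o <;> simp [Function.update_apply]

omit [Fintype V] in
/-- Zeroing an entry of a unit column. [folklore] -/
theorem update_single_zero (u x : V) (y : R) :
    Function.update (Pi.single u y : V → R) x 0 = Pi.single u (if x = u then 0 else y) := by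
  ext i
  by_cases hi : i = x
  · subst hi
    by_cases hu : i = u
    · subst hu; simp
    · simp [hu]
  · rw [Function.update_of_ne hi]
    by_cases hx : x = u
    · subst hx; simp [hi]
    · simp [hx]

omit [Fintype V] in
/-- Updating the zero column with zero. [folklore] -/
theorem update_zero_fun (x : V) : Function.update (0 : V → R) x 0 = 0 := by
  ext i; by_cases hi : i = x <;> simp [hi]

omit [Fintype V] in
/-- Committing a vertex row of the gadget graph. [folklore] -/
theorem gadget_updateRow_vertex (N : Matrix V V R) (u u' v v' : V) (y y' b : R) (x x' : V) :
    (gadget N u u' v v' y y' b).updateRow (some (some (some x))) (Pi.single (some (some (some x'))) 1) =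
      gadget (N.updateRow x (Pi.single x' 1)) u u' v v' (if x = u then 0 else y)
        (if x = u' then 0 else y') b := by
  simp only [gadget, att1_updateRow_some_single_some, update_option_elim_some, update_single_zero,
    update_zero_fun]

omit [Fintype V] in
/-- Entries of the gadget graph: old block. [folklore] -/
theorem gadget_apply_vertex_vertex (N : Matrix V V R) (u u' v v' : V) (y y' b : R) (a w : V) :
    gadget N u u' v v' y y' b (some (some (some a))) (some (some (some w))) = N a w := rfl

omit [Fintype V] in
/-- Entries of the gadget graph: old vertex to `p₁`. [folklore] -/
theorem gadget_apply_vertex_p1 (N : Matrix V V R) (u u' v v' : V) (y y' b : R) (a : V) :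
    gadget N u u' v v' y y' b (some (some (some a))) (some (some none)) = (Pi.single u y : V → R) a := rfl

omit [Fintype V] in
/-- Entries of the gadget graph: old vertex to `p₂`. [folklore] -/
theorem gadget_apply_vertex_p2 (N : Matrix V V R) (u u' v v' : V) (y y' b : R) (a : V) :
    gadget N u u' v v' y y' b (some (some (some a))) (some none) = (Pi.single u' y' : V → R) a := rfl

omit [Fintype V] in
/-- Entries of the gadget graph: old vertex to `p₃`. [folklore] -/
theorem gadget_apply_vertex_p3 (N : Matrix V V R) (u u' v v' : V) (y y' b : R) (a : V) :
    gadget N u u' v v' y y' b (some (some (some a))) none = 0 := rfl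

end GadgetAPI

variable {m : ℕ}

/-- Vertex type of the two-layer graph with `k` gadgets attached. [folklore] -/
def WA (m : ℕ) : ℕ → Type
  | 0 => Fin m ⊕ Fin m
  | k + 1 => Option (Option (Option (WA m k)))

/-- `WA m k` is finite. [folklore] -/
instance instFintypeWA (m : ℕ) : (k : ℕ) → Fintype (WA m k)
  | 0 => inferInstanceAs (Fintype (Fin m ⊕ Fin m))
  | k + 1 => letI := instFintypeWA m k; inferInstanceAs (Fintype (Option (Option (Option (WA m k)))))

/-- `WA m k` has decidable equality. [folklore] -/
instance instDecidableEqWA (m : ℕ) : (k : ℕ) → DecidableEq (WA m k)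
  | 0 => inferInstanceAs (DecidableEq (Fin m ⊕ Fin m))
  | k + 1 => letI := instDecidableEqWA m k; inferInstanceAs (DecidableEq (Option (Option (Option (WA m k)))))

/-- The embedding of the base vertices. [folklore] -/
def ιA (m : ℕ) : (k : ℕ) → Fin m ⊕ Fin m → WA m k
  | 0 => fun x => x
  | k + 1 => fun x => some (some (some (ιA m k x)))

/-- The base embedding is injective. [folklore] -/
theorem ιA_injective (m : ℕ) : ∀ k, Function.Injective (ιA m k)
  | 0 => fun _ _ h => h
  | k + 1 => fun x y h => by
    have h' : (some (some (some (ιA m k x))) : Option (Option (Option (WA m k)))) =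
        some (some (some (ιA m k y))) := h
    exact ιA_injective m k (by simpa using h')

/-- The base two-layer "commitment" matrix: row `inl i` (`inr i`) is the unit vector at `inl j`
(`inr j`) if row `i` is committed to column `j`, and zero if row `i` is free. [folklore] -/
def baseA (c : Fin m → Option (Fin m)) : Matrix (Fin m ⊕ Fin m) (Fin m ⊕ Fin m) R := fun x w =>
  match x, w with
  | Sum.inl i, Sum.inl j => if c i = some j then 1 else 0
  | Sum.inr i, Sum.inr j => if c i = some j then 1 else 0
  | Sum.inl _, Sum.inr _ => 0
  | Sum.inr _, Sum.inl _ => 0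

/-- Row of slot `k` (row-major). [folklore] -/
def rowOf (m : ℕ) [NeZero m] (k : ℕ) : Fin m := Fin.ofNat m (k / m)

/-- Column of slot `k` (row-major). [folklore] -/
def colOf (m : ℕ) [NeZero m] (k : ℕ) : Fin m := Fin.ofNat m k

/-- Row of the row-major slot `i * m + j`. [folklore] -/
theorem rowOf_eq [NeZero m] (i j : Fin m) : rowOf m ((i : ℕ) * m + j) = i := by
  apply Fin.ext
  simp only [rowOf, Fin.val_ofNat]
  have hm : 0 < m := i.pos
  rw [show (i : ℕ) * m + j = j + m * i by ring, Nat.add_mul_div_left _ _ hm,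
    Nat.div_eq_of_lt j.isLt, zero_add, Nat.mod_eq_of_lt i.isLt]

/-- Column of the row-major slot `i * m + j`. [folklore] -/
theorem colOf_eq [NeZero m] (i j : Fin m) : colOf m ((i : ℕ) * m + j) = j := by
  apply Fin.ext
  simp only [colOf, Fin.val_ofNat]
  rw [show (i : ℕ) * m + j = j + m * i by ring, Nat.add_mul_mod_self_left, Nat.mod_eq_of_lt j.isLt]

variable [NeZero m]

/-- The two-layer graph with the gadgets of the slots `< k` attached, in commitment state `c`. [folklore] -/
def MA (b : R) (A : Matrix (Fin m) (Fin m) R) : (k : ℕ) → (Fin m → Option (Fin m)) → Matrix (WA m k) (WA m k) R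
  | 0, c => baseA c
  | k + 1, c => gadget (MA b A k c) (ιA m k (Sum.inl (rowOf m k))) (ιA m k (Sum.inr (rowOf m k)))
      (ιA m k (Sum.inl (colOf m k))) (ιA m k (Sum.inr (colOf m k)))
      (if c (rowOf m k) = none then A (rowOf m k) (colOf m k) else 0)
      (if c (rowOf m k) = none then 1 else 0) b

/-- Unfolding `MA` at a successor. [folklore] -/
theorem MA_succ (b : R) (A : Matrix (Fin m) (Fin m) R) (k : ℕ) (c : Fin m → Option (Fin m)) :
    MA b A (k + 1) c = gadget (MA b A k c) (ιA m k (Sum.inl (rowOf m k))) (ιA m k (Sum.inr (rowOf m k)))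
      (ιA m k (Sum.inl (colOf m k))) (ιA m k (Sum.inr (colOf m k)))
      (if c (rowOf m k) = none then A (rowOf m k) (colOf m k) else 0)
      (if c (rowOf m k) = none then 1 else 0) b := rfl

/-- Unfolding `cycW (MA …)` at a successor, with the vertex type displayed as an iterated `Option`. [folklore] -/
theorem cycW_MA_succ (b : R) (A : Matrix (Fin m) (Fin m) R) (k : ℕ) (c : Fin m → Option (Fin m)) :
    cycW b (MA b A (k + 1) c) = cycW (V := Option (Option (Option (WA m k)))) b
      (gadget (MA b A k c) (ιA m k (Sum.inl (rowOf m k))) (ιA m k (Sum.inr (rowOf m k)))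
        (ιA m k (Sum.inl (colOf m k))) (ιA m k (Sum.inr (colOf m k)))
        (if c (rowOf m k) = none then A (rowOf m k) (colOf m k) else 0)
        (if c (rowOf m k) = none then 1 else 0) b) := rfl

omit [NeZero m] in
/-- Unfolding the base embedding at a successor. [folklore] -/
theorem ιA_succ (k : ℕ) (x : Fin m ⊕ Fin m) : ιA m (k + 1) x = some (some (some (ιA m k x))) := rfl

omit [NeZero m] in
/-- Row updates at level `k+1`, displayed at the iterated `Option` type. [folklore] -/
theorem updateRow_WA_succ (k : ℕ)
    (N : Matrix (Option (Option (Option (WA m k)))) (Option (Option (Option (WA m k)))) R)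
    (x x' : Fin m ⊕ Fin m) :
    Matrix.updateRow (m := WA m (k + 1)) (n := WA m (k + 1)) N (ιA m (k + 1) x)
        (Pi.single (ιA m (k + 1) x') 1) =
      N.updateRow (some (some (some (ιA m k x)))) (Pi.single (some (some (some (ιA m k x')))) 1) := rfl

omit [NeZero m] in
/-- Committing a row of the base two-layer matrix. [folklore] -/
theorem MA_commit_base (c : Fin m → Option (Fin m)) (i j : Fin m) :
    ((baseA (R := R) c).updateRow (Sum.inr i) (Pi.single (Sum.inr j) 1)).updateRow
      (Sum.inl i) (Pi.single (Sum.inl j) 1) = baseA (Function.update c i (some j)) := by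
  ext x w
  rcases x with i' | i' <;> rcases w with j' | j' <;>
    simp only [baseA, Matrix.updateRow_apply, Pi.single_apply, Function.update_apply,
      Sum.inl.injEq, Sum.inr.injEq, reduceCtorEq, if_false] <;>
    split_ifs <;> first | rfl | (subst_vars; simp_all)

/-- Committing row `i` to column `j`. [folklore] -/
theorem MA_commit (b : R) (A : Matrix (Fin m) (Fin m) R) : ∀ (k : ℕ) (c : Fin m → Option (Fin m))
    (i j : Fin m),
    ((MA b A k c).updateRow (ιA m k (Sum.inr i)) (Pi.single (ιA m k (Sum.inr j)) 1)).updateRow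
      (ιA m k (Sum.inl i)) (Pi.single (ιA m k (Sum.inl j)) 1) = MA b A k (Function.update c i (some j))
  | 0, c, i, j => MA_commit_base c i j
  | k + 1, c, i, j => by
    rw [updateRow_WA_succ, updateRow_WA_succ, MA_succ, MA_succ, gadget_updateRow_vertex,
      gadget_updateRow_vertex, MA_commit b A k c i j]
    simp only [(ιA_injective m k).eq_iff, Sum.inl.injEq, reduceCtorEq, if_false, Function.update_apply]
    by_cases h : i = rowOf m k
    · subst h; simp
    · simp [h, Ne.symm h]

/-- A free row whose gadgets are all still to come is a zero row. [folklore] -/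
theorem MA_row_free (b : R) (A : Matrix (Fin m) (Fin m) R) : ∀ (k : ℕ) (c : Fin m → Option (Fin m))
    (i : Fin m), c i = none → k ≤ (i : ℕ) * m → ∀ w, MA b A k c (ιA m k (Sum.inl i)) w = 0
  | 0, c, i, hc, _, w => by
    rcases w with j | j <;> simp [MA, ιA, baseA, hc]
  | k + 1, c, i, hc, hk, w => by
    have hlt : k / m < i := Nat.div_lt_of_lt_mul (by linarith)
    have hne : rowOf m k ≠ i := by
      intro h
      have : (rowOf m k : ℕ) = i := by rw [h]
      simp only [rowOf, Fin.val_ofNat] at this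
      have h2 : k / m % m = k / m := Nat.mod_eq_of_lt (lt_trans hlt i.isLt)
      omega
    rw [MA_succ, ιA_succ]
    rcases w with _ | _ | _ | w
    · exact gadget_apply_vertex_p3 ..
    · rw [gadget_apply_vertex_p2, Pi.single_eq_of_ne]
      exact fun h => Sum.inl_ne_inr (ιA_injective m k h)
    · rw [gadget_apply_vertex_p1, Pi.single_eq_of_ne]
      exact fun h => hne (Sum.inl_injective (ιA_injective m k h)).symm
    · rw [gadget_apply_vertex_vertex]
      exact MA_row_free b A k c i hc (by omega) w

/-- The one-gadget recursion for Stage A. [folklore] -/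
theorem MA_rec (b : R) (A : Matrix (Fin m) (Fin m) R) (i j : Fin m) (c : Fin m → Option (Fin m)) :
    cycW b (MA b A ((i : ℕ) * m + j + 1) c) =
      -(b ^ 2 * (b + 1)) * cycW b (MA b A ((i : ℕ) * m + j) c) +
        b * (if c i = none then A i j * cycW b (MA b A ((i : ℕ) * m + j) (Function.update c i (some j)))
          else 0) := by
  have hne : ιA m ((i : ℕ) * m + j) (Sum.inl i) ≠ ιA m ((i : ℕ) * m + j) (Sum.inr i) :=
    fun h => Sum.inl_ne_inr (ιA_injective m _ h)
  rw [cycW_MA_succ, rowOf_eq, colOf_eq, cycW_gadget _ _ hne, MA_commit]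
  by_cases hc : c i = none
  · simp only [hc, if_true]; ring
  · simp [hc]

omit [NeZero m] in
/-- The only nonzero entry of row `x` of the committed base matrix is at `Sum.map h h x`. [folklore] -/
theorem baseA_apply_of_ne {h : Fin m → Fin m} {x w : Fin m ⊕ Fin m} (hw : w ≠ Sum.map h h x) :
    baseA (R := R) (fun r => some (h r)) x w = 0 := by
  rcases x with i | i <;> rcases w with j | j
  · simp only [baseA]
    rw [if_neg]
    intro h1
    have h2 := Option.some_injective _ h1
    exact hw (by rw [Sum.map_inl, h2])
  · rfl
  · rfl
  · simp only [baseA]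
    rw [if_neg]
    intro h1
    have h2 := Option.some_injective _ h1
    exact hw (by rw [Sum.map_inr, h2])

omit [NeZero m] in
/-- A non-injective commitment has no cover. [folklore] -/
theorem cycW_baseA_of_not_injective (b : R) {h : Fin m → Fin m} (hh : ¬ Function.Injective h) :
    cycW b (baseA (R := R) (fun r => some (h r))) = 0 := by
  unfold cycW
  refine Finset.sum_eq_zero fun τ _ => ?_
  obtain ⟨i, i', hii', hne⟩ := Function.not_injective_iff.1 hh
  by_cases h1 : τ (Sum.inl i) = Sum.map h h (Sum.inl i)
  · have h2 : τ (Sum.inl i') ≠ Sum.map h h (Sum.inl i') := by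
      intro h2
      apply hne
      have : τ (Sum.inl i) = τ (Sum.inl i') := by rw [h1, h2]; simp [hii']
      simpa using τ.injective this
    rw [Finset.prod_eq_zero (f := fun x => baseA (R := R) (fun r => some (h r)) x (τ x))
      (Finset.mem_univ (Sum.inl i')) (baseA_apply_of_ne h2), mul_zero]
  · rw [Finset.prod_eq_zero (f := fun x => baseA (R := R) (fun r => some (h r)) x (τ x))
      (Finset.mem_univ (Sum.inl i)) (baseA_apply_of_ne h1), mul_zero]

omit [NeZero m] in
/-- A bijective commitment `σ` has the single cover `σ ⊕ σ`, with `2 c(σ)` cycles. [folklore] -/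
theorem cycW_baseA_perm (b : R) (σ : Perm (Fin m)) :
    cycW b (baseA (R := R) (fun r => some (σ r))) = b ^ (2 * σ.numCycles) := by
  unfold cycW
  rw [Finset.sum_eq_single (σ.sumCongr σ)]
  · have : ∏ x, baseA (R := R) (fun r => some (σ r)) x ((σ.sumCongr σ) x) = 1 := by
      refine Finset.prod_eq_one fun x _ => ?_
      rcases x with i | i <;> simp [baseA]
    rw [this, mul_one, numCycles_sumCongr, two_mul]
  · intro τ _ hτ
    obtain ⟨x, hx⟩ : ∃ x, τ x ≠ (σ.sumCongr σ) x := not_forall.1 fun hall => hτ (Equiv.ext hall)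
    rw [Finset.prod_eq_zero (f := fun x => baseA (R := R) (fun r => some (σ r)) x (τ x))
      (Finset.mem_univ x) (baseA_apply_of_ne (by simpa [Equiv.Perm.sumCongr_apply] using hx)),
      mul_zero]
  · simp

omit [NeZero m] in
/-- Summing the committed base values against the weights of `A` gives `cycW (β²) A`. [folklore] -/
theorem sum_baseA_eq_cycW (b : R) (A : Matrix (Fin m) (Fin m) R) :
    ∑ h : Fin m → Fin m, (∏ r, A r (h r)) * cycW b (baseA (R := R) (fun r => some (h r))) =
      cycW (b ^ 2) A := by
  rw [show cycW (b ^ 2) A = ∑ σ : Perm (Fin m), (b ^ 2) ^ σ.numCycles * ∏ r, A r (σ r) from rfl]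
  symm
  refine Finset.sum_bij_ne_zero (fun σ _ _ => ⇑σ) (fun σ _ _ => Finset.mem_univ _)
    (fun σ _ _ τ _ _ h => Equiv.ext (congrFun h)) ?_ ?_
  · intro h _ hh
    have hinj : Function.Injective h := by
      by_contra hni
      apply hh
      rw [cycW_baseA_of_not_injective b hni, mul_zero]
    refine ⟨Equiv.ofBijective h (Finite.injective_iff_bijective.1 hinj), Finset.mem_univ _, ?_, rfl⟩
    have heq : (⇑(Equiv.ofBijective h (Finite.injective_iff_bijective.1 hinj)) : Fin m → Fin m) = h := rfl
    rw [heq, ← pow_mul, ← cycW_baseA_perm b (Equiv.ofBijective h (Finite.injective_iff_bijective.1 hinj)),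
      heq, mul_comm]
    exact hh
  · intro σ _ _
    rw [cycW_baseA_perm, pow_mul, mul_comm]

/-- **Stage A** (two coupled copies of the graph of an `m × m` matrix `A`; de Rugy-Altherre 2013,
Lemma 2 with `l = 2`, for the present gadget): the cycle-weighted cover sum of the coupled graph is
`(γ^{m-1} β)^m` times the cover sum of `A` with cycle weight `β²`, `γ = -β²(β+1)`.
[cite: DeRugyAltherre2013, §3 Lemma 2] -/
theorem cycW_MA (b : R) (A : Matrix (Fin m) (Fin m) R) :
    cycW b (MA b A (m * m) (fun _ => none)) = ((-(b ^ 2 * (b + 1))) ^ (m - 1) * b) ^ m * cycW (b ^ 2) A := by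
  have := unroll_rowMajor (-(b ^ 2 * (b + 1))) b (fun i j => A i j) (fun k c => cycW b (MA b A k c))
    (fun i j c => MA_rec b A i j c)
    (fun i c hc k hk => cycW_eq_zero_of_row_eq_zero b (ιA m k (Sum.inl i)) (MA_row_free b A k c i hc hk))
  rw [this]
  congr 1
  exact sum_baseA_eq_cycW b A

end StageA


/-! ### Stage B: averaging over the second factor (replaces the Vandermonde interpolation) -/

section StageB

variable {R : Type*} [CommRing R] {n : ℕ}

/-- Vertex type of the averaging graph with `k` pass-vertices attached. [folklore] -/
def WB (n : ℕ) : ℕ → Type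
  | 0 => Fin n ⊕ Fin n
  | k + 1 => Option (WB n k)

/-- `WB n k` is finite. [folklore] -/
instance instFintypeWB (n : ℕ) : (k : ℕ) → Fintype (WB n k)
  | 0 => inferInstanceAs (Fintype (Fin n ⊕ Fin n))
  | k + 1 => letI := instFintypeWB n k; inferInstanceAs (Fintype (Option (WB n k)))

/-- `WB n k` has decidable equality. [folklore] -/
instance instDecidableEqWB (n : ℕ) : (k : ℕ) → DecidableEq (WB n k)
  | 0 => inferInstanceAs (DecidableEq (Fin n ⊕ Fin n))
  | k + 1 => letI := instDecidableEqWB n k; inferInstanceAs (DecidableEq (Option (WB n k)))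

/-- The embedding of the base vertices. [folklore] -/
def ιB (n : ℕ) : (k : ℕ) → Fin n ⊕ Fin n → WB n k
  | 0 => fun x => x
  | k + 1 => fun x => some (ιB n k x)

/-- The base embedding is injective. [folklore] -/
theorem ιB_injective (n : ℕ) : ∀ k, Function.Injective (ιB n k)
  | 0 => fun _ _ h => h
  | k + 1 => fun x y h => by
    have h' : (some (ιB n k x) : Option (WB n k)) = some (ιB n k y) := h
    exact ιB_injective n k (by simpa using h')

/-- Unfolding the base embedding at a successor. [folklore] -/
theorem ιB_succ (k : ℕ) (x : Fin n ⊕ Fin n) : ιB n (k + 1) x = some (ιB n k x) := rfl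

/-- The base averaging matrix: row `inl i` is the unit vector at `inr j` if row `i` is committed
to column `j` (zero if free); row `inr j` has ones on all `inl` columns. [folklore] -/
def baseB (c : Fin n → Option (Fin n)) : Matrix (Fin n ⊕ Fin n) (Fin n ⊕ Fin n) R := fun x w =>
  match x, w with
  | Sum.inl i, Sum.inr j => if c i = some j then 1 else 0
  | Sum.inr _, Sum.inl _ => 1
  | Sum.inl _, Sum.inl _ => 0
  | Sum.inr _, Sum.inr _ => 0

variable [NeZero n]

/-- The averaging graph with the pass-vertices of the slots `< k` attached: the pass-vertex of slot
`(i, j)` is entered from `inl i` with weight `X i j` and exits to `inr j`. [folklore] -/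
def MB (b : R) (X : Matrix (Fin n) (Fin n) R) : (k : ℕ) → (Fin n → Option (Fin n)) → Matrix (WB n k) (WB n k) R
  | 0, c => baseB c
  | k + 1, c => att1 (MB b X k c)
      (Pi.single (ιB n k (Sum.inl (rowOf n k))) (if c (rowOf n k) = none then X (rowOf n k) (colOf n k) else 0))
      (Pi.single (ιB n k (Sum.inr (colOf n k))) 1) 1

/-- Unfolding `MB` at a successor. [folklore] -/
theorem MB_succ (b : R) (X : Matrix (Fin n) (Fin n) R) (k : ℕ) (c : Fin n → Option (Fin n)) :
    MB b X (k + 1) c = att1 (MB b X k c)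
      (Pi.single (ιB n k (Sum.inl (rowOf n k))) (if c (rowOf n k) = none then X (rowOf n k) (colOf n k) else 0))
      (Pi.single (ιB n k (Sum.inr (colOf n k))) 1) 1 := rfl

/-- Unfolding `cycW (MB …)` at a successor, with the vertex type displayed as an `Option`. [folklore] -/
theorem cycW_MB_succ (b : R) (X : Matrix (Fin n) (Fin n) R) (k : ℕ) (c : Fin n → Option (Fin n)) :
    cycW b (MB b X (k + 1) c) = cycW (V := Option (WB n k)) b (att1 (MB b X k c)
      (Pi.single (ιB n k (Sum.inl (rowOf n k))) (if c (rowOf n k) = none then X (rowOf n k) (colOf n k) else 0))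
      (Pi.single (ιB n k (Sum.inr (colOf n k))) 1) 1) := rfl

omit [NeZero n] in
/-- Row updates at level `k+1`, displayed at the `Option` type. [folklore] -/
theorem updateRow_WB_succ (k : ℕ) (N : Matrix (Option (WB n k)) (Option (WB n k)) R)
    (x x' : Fin n ⊕ Fin n) :
    Matrix.updateRow (m := WB n (k + 1)) (n := WB n (k + 1)) N (ιB n (k + 1) x)
        (Pi.single (ιB n (k + 1) x') 1) =
      N.updateRow (some (ιB n k x)) (Pi.single (some (ιB n k x')) 1) := rfl

omit [NeZero n] in
/-- Committing a row of the base averaging matrix. [folklore] -/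
theorem MB_commit_base (c : Fin n → Option (Fin n)) (i j : Fin n) :
    (baseB (R := R) c).updateRow (Sum.inl i) (Pi.single (Sum.inr j) 1) =
      baseB (Function.update c i (some j)) := by
  ext x w
  rcases x with i' | i' <;> rcases w with j' | j' <;>
    simp only [baseB, Matrix.updateRow_apply, Pi.single_apply, Function.update_apply,
      Sum.inl.injEq, Sum.inr.injEq, reduceCtorEq, if_false] <;>
    split_ifs <;> first | rfl | (subst_vars; simp_all)

/-- Committing row `i` to column `j`. [folklore] -/
theorem MB_commit (b : R) (X : Matrix (Fin n) (Fin n) R) : ∀ (k : ℕ) (c : Fin n → Option (Fin n))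
    (i j : Fin n),
    (MB b X k c).updateRow (ιB n k (Sum.inl i)) (Pi.single (ιB n k (Sum.inr j)) 1) =
      MB b X k (Function.update c i (some j))
  | 0, c, i, j => MB_commit_base c i j
  | k + 1, c, i, j => by
    rw [updateRow_WB_succ, MB_succ, MB_succ, att1_updateRow_some_single_some, MB_commit b X k c i j,
      update_single_zero]
    simp only [(ιB_injective n k).eq_iff, Sum.inl.injEq, Function.update_apply]
    by_cases h : i = rowOf n k
    · subst h; simp
    · simp [h, Ne.symm h]

/-- A free row whose pass-vertices are all still to come is a zero row. [folklore] -/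
theorem MB_row_free (b : R) (X : Matrix (Fin n) (Fin n) R) : ∀ (k : ℕ) (c : Fin n → Option (Fin n))
    (i : Fin n), c i = none → k ≤ (i : ℕ) * n → ∀ w, MB b X k c (ιB n k (Sum.inl i)) w = 0
  | 0, c, i, hc, _, w => by
    rcases w with j | j <;> simp [MB, ιB, baseB, hc]
  | k + 1, c, i, hc, hk, w => by
    have hlt : k / n < i := Nat.div_lt_of_lt_mul (by linarith)
    have hne : rowOf n k ≠ i := by
      intro h
      have : (rowOf n k : ℕ) = i := by rw [h]
      simp only [rowOf, Fin.val_ofNat] at this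
      have h2 : k / n % n = k / n := Nat.mod_eq_of_lt (lt_trans hlt i.isLt)
      omega
    rw [MB_succ, ιB_succ]
    rcases w with _ | w
    · rw [att1_some_none, Pi.single_eq_of_ne]
      exact fun h => hne (Sum.inl_injective (ιB_injective n k h)).symm
    · rw [att1_some_some]
      exact MB_row_free b X k c i hc (by omega) w

/-- The one-vertex recursion for Stage B. [folklore] -/
theorem MB_rec (b : R) (X : Matrix (Fin n) (Fin n) R) (i j : Fin n) (c : Fin n → Option (Fin n)) :
    cycW b (MB b X ((i : ℕ) * n + j + 1) c) =
      b * cycW b (MB b X ((i : ℕ) * n + j) c) +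
        1 * (if c i = none then X i j * cycW b (MB b X ((i : ℕ) * n + j) (Function.update c i (some j)))
          else 0) := by
  rw [cycW_MB_succ, rowOf_eq, colOf_eq, cycW_att1_single_single, MB_commit]
  by_cases hc : c i = none
  · simp only [hc, if_true]; ring
  · simp [hc]

omit [NeZero n] in
/-- The only nonzero entry of row `inl i` of the committed base matrix is at `inr (h i)`. [folklore] -/
theorem baseB_apply_inl_of_ne {h : Fin n → Fin n} {i : Fin n} {w : Fin n ⊕ Fin n}
    (hw : w ≠ Sum.inr (h i)) : baseB (R := R) (fun r => some (h r)) (Sum.inl i) w = 0 := by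
  rcases w with j | j
  · rfl
  · simp only [baseB]
    rw [if_neg]
    intro h1
    have h2 := Option.some_injective _ h1
    exact hw (by rw [h2])

omit [NeZero n] in
/-- A non-injective commitment has no cover. [folklore] -/
theorem cycW_baseB_of_not_injective (b : R) {h : Fin n → Fin n} (hh : ¬ Function.Injective h) :
    cycW b (baseB (R := R) (fun r => some (h r))) = 0 := by
  unfold cycW
  refine Finset.sum_eq_zero fun τ _ => ?_
  obtain ⟨i, i', hii', hne⟩ := Function.not_injective_iff.1 hh
  by_cases h1 : τ (Sum.inl i) = Sum.inr (h i)
  · have h2 : τ (Sum.inl i') ≠ Sum.inr (h i') := by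
      intro h2
      apply hne
      have : τ (Sum.inl i) = τ (Sum.inl i') := by rw [h1, h2, hii']
      simpa using τ.injective this
    rw [Finset.prod_eq_zero (f := fun x => baseB (R := R) (fun r => some (h r)) x (τ x))
      (Finset.mem_univ (Sum.inl i')) (baseB_apply_inl_of_ne h2), mul_zero]
  · rw [Finset.prod_eq_zero (f := fun x => baseB (R := R) (fun r => some (h r)) x (τ x))
      (Finset.mem_univ (Sum.inl i)) (baseB_apply_inl_of_ne h1), mul_zero]

omit [NeZero n] in
/-- A bijective commitment is a reindexing of the identity commitment. [folklore] -/
theorem baseB_perm_eq_submatrix (σ : Perm (Fin n)) :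
    baseB (R := R) (fun r => some (σ r)) =
      (baseB (R := R) (fun r => some r)).submatrix (Equiv.sumCongr (Equiv.refl (Fin n)) σ.symm)
        (Equiv.sumCongr (Equiv.refl (Fin n)) σ.symm) := by
  ext x w
  rcases x with i | i <;> rcases w with j | j <;>
    simp [baseB, Matrix.submatrix_apply, Equiv.eq_symm_apply, eq_comm]

/-- The averaging constant `K_n(β) = cycW β (baseB id) = ∑_τ β^{c(Σ_{1,τ})}`. [folklore] -/
def avgConst (R : Type*) [CommRing R] (n : ℕ) (b : R) : R :=
  cycW b (baseB (R := R) (n := n) (fun r => some r))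

omit [NeZero n] in
/-- Every bijective commitment has the same cover sum `K_n(β)` (conjugation invariance). [folklore] -/
theorem cycW_baseB_perm (b : R) (σ : Perm (Fin n)) :
    cycW b (baseB (R := R) (fun r => some (σ r))) = avgConst R n b := by
  rw [baseB_perm_eq_submatrix, cycW_submatrix]
  rfl

omit [NeZero n] in
/-- Summing the committed base values against the weights of `X` gives `K_n(β) · per X`. [folklore] -/
theorem sum_baseB_eq_permanent (b : R) (X : Matrix (Fin n) (Fin n) R) :
    ∑ h : Fin n → Fin n, (∏ r, X r (h r)) * cycW b (baseB (R := R) (fun r => some (h r))) =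
      avgConst R n b * X.permanent := by
  rw [← Matrix.permanent_transpose, Matrix.permanent, Finset.mul_sum]
  symm
  refine Finset.sum_bij_ne_zero (fun σ _ _ => ⇑σ) (fun σ _ _ => Finset.mem_univ _)
    (fun σ _ _ τ _ _ h => Equiv.ext (congrFun h)) ?_ ?_
  · intro h _ hh
    have hinj : Function.Injective h := by
      by_contra hni
      apply hh
      rw [cycW_baseB_of_not_injective b hni, mul_zero]
    refine ⟨Equiv.ofBijective h (Finite.injective_iff_bijective.1 hinj), Finset.mem_univ _, ?_, rfl⟩
    have heq : (⇑(Equiv.ofBijective h (Finite.injective_iff_bijective.1 hinj)) : Fin n → Fin n) = h := rfl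
    simp only [Matrix.transpose_apply, heq]
    rw [← cycW_baseB_perm b (Equiv.ofBijective h (Finite.injective_iff_bijective.1 hinj)), heq, mul_comm]
    exact hh
  · intro σ _ _
    simp only [Matrix.transpose_apply]
    rw [cycW_baseB_perm, mul_comm]

/-- **Stage B** (averaging): the cycle-weighted cover sum of the averaging graph of `X` equals
`β^{(n-1)n} · K_n(β) · per X`. [folklore] -/
theorem cycW_MB (b : R) (X : Matrix (Fin n) (Fin n) R) :
    cycW b (MB b X (n * n) (fun _ => none)) = (b ^ (n - 1) * 1) ^ n * (avgConst R n b * X.permanent) := by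
  have := unroll_rowMajor b 1 (fun i j => X i j) (fun k c => cycW b (MB b X k c))
    (fun i j c => MB_rec b X i j c)
    (fun i c hc k hk => cycW_eq_zero_of_row_eq_zero b (ιB n k (Sum.inl i)) (MB_row_free b X k c i hc hk))
  rw [this]
  congr 1
  exact sum_baseB_eq_permanent b X

end StageB


/-! ### Cardinalities, base change, positivity of the averaging constant -/

section Cards

/-- `card (WB n k) = 2n + k`. [folklore] -/
theorem card_WB (n : ℕ) : ∀ k, Fintype.card (WB n k) = 2 * n + k
  | 0 => by
    show Fintype.card (Fin n ⊕ Fin n) = _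
    simp [Fintype.card_sum, two_mul]
  | k + 1 => by
    show @Fintype.card (Option (WB n k)) (@instFintypeOption _ (instFintypeWB n k)) = _
    rw [Fintype.card_option, card_WB n k]
    ring

/-- `card (WA m k) = 2m + 3k`. [folklore] -/
theorem card_WA (m : ℕ) : ∀ k, Fintype.card (WA m k) = 2 * m + 3 * k
  | 0 => by
    show Fintype.card (Fin m ⊕ Fin m) = _
    simp [Fintype.card_sum, two_mul]
  | k + 1 => by
    show @Fintype.card (Option (Option (Option (WA m k))))
      (@instFintypeOption _ (@instFintypeOption _ (@instFintypeOption _ (instFintypeWA m k)))) = _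
    rw [Fintype.card_option, Fintype.card_option, Fintype.card_option, card_WA m k]
    ring

/-- `WB n k` is nonempty when `n ≠ 0`. [folklore] -/
instance neZero_card_WB (n k : ℕ) [NeZero n] : NeZero (Fintype.card (WB n k)) :=
  ⟨by rw [card_WB]; have := NeZero.ne n; omega⟩

end Cards

section MapLemmas

variable {R : Type*} [CommRing R] {S : Type*} [CommRing S]
variable {V : Type*} [Fintype V] [DecidableEq V]

/-- `cycW` commutes with ring homomorphisms. [folklore] -/
theorem map_cycW (f : R →+* S) (b : R) (M : Matrix V V R) :
    f (cycW b M) = cycW (f b) (M.map f) := by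
  unfold cycW
  simp [map_sum, map_mul, map_prod, map_pow]

/-- The base averaging matrix has entries `0, 1` and is preserved by ring homomorphisms. [folklore] -/
theorem baseB_map {n : ℕ} (f : R →+* S) (c : Fin n → Option (Fin n)) :
    (baseB (R := R) c).map f = baseB (R := S) c := by
  ext x w
  rcases x with i | i <;> rcases w with j | j <;> simp [baseB, apply_ite f]

/-- The averaging constant commutes with ring homomorphisms. [folklore] -/
theorem map_avgConst {n : ℕ} (f : R →+* S) (b : R) : f (avgConst R n b) = avgConst S n (f b) := by
  unfold avgConst
  rw [map_cycW, baseB_map]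

end MapLemmas

section Positivity

variable {n : ℕ}

/-- Over `ℚ` the base averaging matrix has nonnegative entries. [folklore] -/
theorem baseB_nonneg (c : Fin n → Option (Fin n)) (x w : Fin n ⊕ Fin n) : 0 ≤ baseB (R := ℚ) c x w := by
  rcases x with i | i <;> rcases w with j | j <;> simp only [baseB] <;> positivity

/-- Over `ℚ`, `K_n(q) > 0` for `q > 0`: all covers contribute nonnegatively and the swap `inl i ↔ inr i` contributes `q^{c} > 0`. [folklore] -/
theorem avgConst_pos (q : ℚ) (hq : 0 < q) : 0 < avgConst ℚ n q := by
  unfold avgConst cycW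
  refine Finset.sum_pos' (fun τ _ => mul_nonneg (pow_nonneg hq.le _)
    (Finset.prod_nonneg fun x _ => baseB_nonneg _ _ _)) ⟨Equiv.sumComm (Fin n) (Fin n), Finset.mem_univ _, ?_⟩
  have : ∏ x, baseB (R := ℚ) (fun r => some r) x ((Equiv.sumComm (Fin n) (Fin n)) x) = 1 := by
    refine Finset.prod_eq_one fun x _ => ?_
    rcases x with i | i <;> simp [baseB]
  rw [this, mul_one]
  exact pow_pos hq _

/-- In a field of characteristic zero, `K_n(t²) ≠ 0` for rational `t ≠ 0`. [folklore] -/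
theorem avgConst_ne_zero (K : Type*) [Field K] [CharZero K] (t : ℚ) (ht : t ≠ 0) :
    avgConst K n ((t : K) ^ 2) ≠ 0 := by
  have h := avgConst_pos (n := n) (t ^ 2) (by positivity)
  have : avgConst K n ((t : K) ^ 2) = Rat.castHom K (avgConst ℚ n (t ^ 2)) := by
    rw [map_avgConst]
    simp
  rw [this, map_ne_zero]
  exact h.ne'

end Positivity

/-! ### The link with the fermionic pencil -/

section Pencil

variable {K : Type*} [Field K]

/-- The cycle formula for the sign: `sgn τ · t^{c(τ)} = (-1)^{card W} (-t)^{c(τ)}`. [folklore] -/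
theorem sign_mul_pow_eq {W : Type*} [Fintype W] [DecidableEq W] (τ : Perm W) (t : K) :
    ((Equiv.Perm.sign τ : ℤ) : K) * t ^ τ.numCycles = (-1) ^ Fintype.card W * (-t) ^ τ.numCycles := by
  have h := Equiv.Perm.sign_mul_neg_one_pow_numCycles τ
  have h3 : (Equiv.Perm.sign τ : ℤ) = (-1) ^ Fintype.card W * (-1) ^ τ.numCycles := by
    calc (Equiv.Perm.sign τ : ℤ)
        = (Equiv.Perm.sign τ : ℤ) * ((-1) ^ τ.numCycles * (-1) ^ τ.numCycles) := by
          rw [← pow_add, ← two_mul, pow_mul, neg_one_sq, one_pow, mul_one]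
      _ = ((Equiv.Perm.sign τ : ℤ) * (-1) ^ τ.numCycles) * (-1) ^ τ.numCycles := by ring
      _ = (-1) ^ Fintype.card W * (-1) ^ τ.numCycles := by rw [h]
  have h4 : ((Equiv.Perm.sign τ : ℤ) : K) = ((-1 : K) ^ Fintype.card W) * ((-1 : K) ^ τ.numCycles) := by
    have := congrArg (Int.cast : ℤ → K) h3
    push_cast at this
    exact this
  rw [h4, neg_pow t]
  ring

/-- Substituting the entries of a matrix `M` (reindexed to `Fin N`) into the fermionic pencil gives
`(-1)^N` times the cycle-weighted cover sum of `M` with cycle weight `-t`: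
`Ferm^t(M) = ∑_σ sgn σ t^{c(σ)} M^σ = (-1)^N ∑_σ (-t)^{c(σ)} M^σ`. [cite: DeRugyAltherre2013, §3] -/
theorem aeval_fermionicPencil_eq_cycW {σ : Type*} {W : Type*} [Fintype W] [DecidableEq W] {N : ℕ}
    (e : W ≃ Fin N) (M : Matrix W W (MvPolynomial σ K)) (t : K) :
    MvPolynomial.aeval (fun pq : Fin N × Fin N => M (e.symm pq.1) (e.symm pq.2))
        (fermionicPencil (Fin N) K t) =
      MvPolynomial.C ((-1 : K) ^ N) * cycW (MvPolynomial.C (-t)) M := by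
  have hcard : Fintype.card W = N := by simpa using Fintype.card_congr e
  unfold fermionicPencil cycW
  simp only [map_sum, map_mul, MvPolynomial.aeval_C, map_prod, MvPolynomial.aeval_X,
    MvPolynomial.algebraMap_eq]
  rw [Finset.mul_sum]
  refine Fintype.sum_equiv ((e.symm.permCongr).trans (Equiv.inv (Perm W))) _ _ fun τ => ?_
  simp only [Equiv.trans_apply, Equiv.inv_apply]
  rw [numCycles_inv, numCycles_permCongr]
  have hprod : ∏ i, M (e.symm (τ i)) (e.symm i) = ∏ w, M w ((e.symm.permCongr τ)⁻¹ w) := by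
    rw [← Fintype.prod_equiv (e.symm.permCongr τ) (fun v => M ((e.symm.permCongr τ) v) v)
      (fun w => M w ((e.symm.permCongr τ)⁻¹ w))
      (fun v => by rw [Equiv.Perm.inv_def, Equiv.symm_apply_apply])]
    exact Fintype.prod_equiv e.symm _ _ (fun i => by simp [Equiv.permCongr_apply])
  rw [hprod, ← MvPolynomial.C_pow, ← mul_assoc]
  congr 1
  have key := sign_mul_pow_eq (e.symm.permCongr τ) t
  rw [Equiv.Perm.sign_permCongr, numCycles_permCongr, hcard] at key
  rw [← MvPolynomial.C_mul, ← MvPolynomial.C_mul, key]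

end Pencil

/-! ### Entries are variables or constants -/

section VarOrConst

variable {K : Type*} [Field K] {ι : Type*}

/-- "A variable or a constant" (the condition in `IsProjection`). [folklore] -/
def VOC (f : MvPolynomial ι K) : Prop := (∃ j, f = MvPolynomial.X j) ∨ ∃ c, f = MvPolynomial.C c

/-- A variable is a variable or a constant. [folklore] -/
theorem VOC_X (j : ι) : VOC (MvPolynomial.X j : MvPolynomial ι K) := Or.inl ⟨j, rfl⟩
/-- A constant is a variable or a constant. [folklore] -/
theorem VOC_C (c : K) : VOC (MvPolynomial.C c : MvPolynomial ι K) := Or.inr ⟨c, rfl⟩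
/-- `0` is a constant. [folklore] -/
theorem VOC_zero : VOC (0 : MvPolynomial ι K) := Or.inr ⟨0, by simp⟩
/-- `1` is a constant. [folklore] -/
theorem VOC_one : VOC (1 : MvPolynomial ι K) := Or.inr ⟨1, by simp⟩
/-- `if-then-else` of variables-or-constants. [folklore] -/
theorem VOC_ite (p : Prop) [Decidable p] {f g : MvPolynomial ι K} (hf : VOC f) (hg : VOC g) :
    VOC (if p then f else g) := by
  split_ifs <;> assumption
/-- `-C c` is a constant. [folklore] -/
theorem VOC_neg_C (c : K) : VOC (-MvPolynomial.C c : MvPolynomial ι K) := Or.inr ⟨-c, by simp⟩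

/-- Entries of a unit column with a variable-or-constant value. [folklore] -/
theorem VOC_single {V : Type*} [DecidableEq V] {y : MvPolynomial ι K} (hy : VOC y) (u a : V) :
    VOC ((Pi.single u y : V → MvPolynomial ι K) a) := by
  rw [Pi.single_apply]
  exact VOC_ite _ hy VOC_zero

/-- `att1` preserves "entries are variables or constants". [folklore] -/
theorem att1_VOC {V : Type*} [Fintype V] [DecidableEq V] {N : Matrix V V (MvPolynomial ι K)}
    {col row : V → MvPolynomial ι K} {d : MvPolynomial ι K}
    (hN : ∀ a w, VOC (N a w)) (hcol : ∀ a, VOC (col a)) (hrow : ∀ w, VOC (row w)) (hd : VOC d) :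
    ∀ x w, VOC (att1 N col row d x w) := by
  rintro (_ | x) (_ | w)
  · exact hd
  · exact hrow w
  · exact hcol x
  · exact hN x w

/-- The gadget graph preserves "entries are variables or constants". [folklore] -/
theorem gadget_VOC {V : Type*} [Fintype V] [DecidableEq V] {N : Matrix V V (MvPolynomial ι K)}
    (hN : ∀ a w, VOC (N a w)) (u u' v v' : V) {y y' b : MvPolynomial ι K} (hy : VOC y) (hy' : VOC y')
    (hb : VOC (-b)) : ∀ x w, VOC (gadget N u u' v v' y y' b x w) := by
  unfold gadget
  refine att1_VOC (att1_VOC (att1_VOC hN (fun a => VOC_single hy u a) (fun w => VOC_single VOC_one v w)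
    VOC_one) ?_ ?_ VOC_one) ?_ ?_ VOC_one
  · rintro (_ | a)
    · exact VOC_one
    · exact VOC_single hy' u' a
  · rintro (_ | w)
    · exact VOC_one
    · exact VOC_single VOC_one v' w
  · rintro (_ | _ | a)
    · exact VOC_one
    · exact VOC_one
    · exact VOC_zero
  · rintro (_ | _ | a)
    · exact hb
    · exact hb
    · exact VOC_zero

/-- The averaging matrices have entries that are variables or constants. [folklore] -/
theorem MB_VOC {n : ℕ} [NeZero n] (b : MvPolynomial ι K) {X : Matrix (Fin n) (Fin n) (MvPolynomial ι K)}
    (hX : ∀ i j, VOC (X i j)) : ∀ (k : ℕ) (c : Fin n → Option (Fin n)) (x w), VOC (MB b X k c x w)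
  | 0, c, x, w => by
    rcases x with i | i <;> rcases w with j | j
    · exact VOC_zero
    · exact VOC_ite _ VOC_one VOC_zero
    · exact VOC_one
    · exact VOC_zero
  | k + 1, c, x, w =>
    att1_VOC (MB_VOC b hX k c) (fun a => VOC_single (VOC_ite _ (hX _ _) VOC_zero) _ a)
      (fun w => VOC_single VOC_one _ w) VOC_one x w

/-- The coupled matrices have entries that are variables or constants. [folklore] -/
theorem MA_VOC {m : ℕ} [NeZero m] {b : MvPolynomial ι K} (hb : VOC (-b))
    {A : Matrix (Fin m) (Fin m) (MvPolynomial ι K)}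
    (hA : ∀ i j, VOC (A i j)) : ∀ (k : ℕ) (c : Fin m → Option (Fin m)) (x w), VOC (MA b A k c x w)
  | 0, c, x, w => by
    rcases x with i | i <;> rcases w with j | j
    · exact VOC_ite _ VOC_one VOC_zero
    · exact VOC_zero
    · exact VOC_zero
    · exact VOC_ite _ VOC_one VOC_zero
  | k + 1, c, x, w =>
    gadget_VOC (MA_VOC hb hA k c) _ _ _ _ (VOC_ite _ (hA _ _) VOC_zero) (VOC_ite _ VOC_one VOC_zero) hb x w

end VarOrConst

/-! ### The composite reduction and the proof of Theorem 1 -/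

section Composite

variable (K : Type*) [Field K] (n : ℕ) [NeZero n] (t : ℚ)

/-- The ring of the generic `n × n` matrix. [folklore] -/
abbrev Rn : Type _ := MvPolynomial (Fin n × Fin n) K

/-- Cycle weight of the outer stage: `β = -t`. [folklore] -/
def bA : Rn K n := MvPolynomial.C (-(t : K))

/-- Cycle weight of the inner stage: `β² = t²`. [folklore] -/
def bB : Rn K n := MvPolynomial.C ((t : K) ^ 2)

/-- The inner (averaging) matrix on the generic matrix. [folklore] -/
def innerM : Matrix (WB n (n * n)) (WB n (n * n)) (Rn K n) :=
  MB (bB K n t) (Matrix.mvPolynomialX (Fin n) (Fin n) K) (n * n) (fun _ => none)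

/-- Size of the inner matrix. [folklore] -/
abbrev mB : ℕ := Fintype.card (WB n (n * n))

/-- The inner matrix reindexed by `Fin mB`. [folklore] -/
def Ain : Matrix (Fin (mB n)) (Fin (mB n)) (Rn K n) :=
  (innerM K n t).submatrix (Fintype.equivFin (WB n (n * n))).symm (Fintype.equivFin (WB n (n * n))).symm

/-- The outer (two coupled layers) matrix. [folklore] -/
def outerM : Matrix (WA (mB n) (mB n * mB n)) (WA (mB n) (mB n * mB n)) (Rn K n) :=
  MA (bA K n t) (Ain K n t) (mB n * mB n) (fun _ => none)

/-- Total size `N(n) = 2 m_B + 3 m_B²`, `m_B = 2n + n²`. [folklore] -/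
def Nsize (n : ℕ) : ℕ := 2 * (2 * n + n * n) + 3 * ((2 * n + n * n) * (2 * n + n * n))

omit [NeZero n] in
/-- The outer vertex type has `N(n)` elements. [folklore] -/
theorem card_outer : Fintype.card (WA (mB n) (mB n * mB n)) = Nsize n := by
  rw [card_WA, show mB n = 2 * n + n * n from card_WB n (n * n), Nsize]

/-- The reindexing of the outer matrix to `Fin N(n)`. [folklore] -/
def eOut : WA (mB n) (mB n * mB n) ≃ Fin (Nsize n) := Fintype.equivFinOfCardEq (card_outer n)

/-- The substitution realising the permanent as a projection of the fermionic pencil. [folklore] -/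
def φsub : Fin (Nsize n) × Fin (Nsize n) → Rn K n :=
  fun pq => outerM K n t ((eOut n).symm pq.1) ((eOut n).symm pq.2)

/-- The scalar of the reduction. [folklore] -/
def κ : K :=
  (-1 : K) ^ Nsize n *
    (((-((-(t : K)) ^ 2 * (-(t : K) + 1))) ^ (mB n - 1) * (-(t : K))) ^ mB n *
      ((((t : K) ^ 2) ^ (n - 1) * 1) ^ n * avgConst K n ((t : K) ^ 2)))

/-- Every value of the substitution is a variable or a constant. [folklore] -/
theorem φsub_VOC (pq : Fin (Nsize n) × Fin (Nsize n)) : VOC (φsub K n t pq) := by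
  unfold φsub outerM
  refine MA_VOC (by unfold bA; rw [← map_neg, neg_neg]; exact VOC_C _) (fun i j => ?_) _ _ _ _
  unfold Ain innerM
  rw [Matrix.submatrix_apply]
  exact MB_VOC _ (fun i j => VOC_X _) _ _ _ _

/-- **The reduction identity**: the permanent of the generic `n × n` matrix, times the nonzero
scalar `κ`, is the substitution `φsub` of variables and constants into `Ferm^t_{N(n)}`.
[cite: DeRugyAltherre2013, Thm. 1 (§3)] -/
theorem aeval_fermionicPencil_eq_perPoly :
    MvPolynomial.aeval (φsub K n t) (fermionicPencil (Fin (Nsize n)) K (t : K)) =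
      MvPolynomial.C (κ K n t) * perPoly (Fin n) K := by
  unfold φsub
  rw [aeval_fermionicPencil_eq_cycW (eOut n) (outerM K n t) (t : K)]
  unfold outerM
  rw [show (MvPolynomial.C (-(t : K)) : Rn K n) = bA K n t from rfl, cycW_MA]
  unfold Ain
  rw [cycW_submatrix, show bA K n t ^ 2 = bB K n t by
    unfold bA bB; rw [← map_pow, neg_sq]]
  unfold innerM
  rw [cycW_MB, show avgConst (Rn K n) n (bB K n t) = MvPolynomial.C (avgConst K n ((t : K) ^ 2)) by
    unfold bB; rw [map_avgConst]]
  unfold κ bA bB perPoly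
  simp only [map_mul, map_pow, map_neg, map_add, map_one]
  ring

omit [NeZero n] in
/-- The scalar of the reduction is nonzero for `t ∉ {0, 1}`. [folklore] -/
theorem κ_ne_zero [CharZero K] (ht0 : t ≠ 0) (ht1 : t ≠ 1) : κ K n t ≠ 0 := by
  have h0 : (t : K) ≠ 0 := by exact_mod_cast ht0
  have h1 : (-(t : K) + 1) ≠ 0 := by
    intro h
    apply ht1
    have : (t : K) = 1 := by linear_combination -h
    exact_mod_cast this
  unfold κ
  refine mul_ne_zero (pow_ne_zero _ (by norm_num)) (mul_ne_zero ?_ (mul_ne_zero ?_ ?_))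
  · exact pow_ne_zero _ (mul_ne_zero (pow_ne_zero _ (neg_ne_zero.2 (mul_ne_zero (pow_ne_zero _
      (neg_ne_zero.2 h0)) h1))) (neg_ne_zero.2 h0))
  · rw [mul_one]; exact pow_ne_zero _ (pow_ne_zero _ (pow_ne_zero _ h0))
  · exact avgConst_ne_zero K t ht0

/-- The permanent is a nonzero scalar multiple of a projection of the fermionic pencil. [folklore] -/
theorem perPoly_eq_smul_aeval [CharZero K] (ht0 : t ≠ 0) (ht1 : t ≠ 1) :
    perPoly (Fin n) K =
      (κ K n t)⁻¹ • MvPolynomial.aeval (φsub K n t) (fermionicPencil (Fin (Nsize n)) K (t : K)) := by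
  rw [aeval_fermionicPencil_eq_perPoly, MvPolynomial.smul_eq_C_mul, ← mul_assoc, ← map_mul,
    inv_mul_cancel₀ (κ_ne_zero K n t ht0 ht1), map_one, one_mul]

/-- Complexity consequence for `n ≥ 1`. [folklore] -/
theorem complexity_perPoly_le [CharZero K] (ht0 : t ≠ 0) (ht1 : t ≠ 1) :
    complexity (perPoly (Fin n) K) ≤ complexity (fermionicPencil (Fin (Nsize n)) K (t : K)) + 1 := by
  rw [perPoly_eq_smul_aeval K n t ht0 ht1]
  refine (complexity_smul_le_holds _ _).trans (Nat.add_le_add_right ?_ 1)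
  exact complexity_le_of_isProjection ⟨φsub K n t, φsub_VOC K n t, rfl⟩

end Composite

/-- `N(n)` is p-bounded. [folklore] -/
theorem Nsize_isPBounded : IsPBounded Nsize := by
  have h1 : IsPBounded (fun n => 2 * n + n * n) :=
    IsPBounded.add_holds (IsPBounded.mul_holds (IsPBounded.const 2) IsPBounded.id)
      (IsPBounded.mul_holds IsPBounded.id IsPBounded.id)
  exact IsPBounded.add_holds (IsPBounded.mul_holds (IsPBounded.const 2) h1)
    (IsPBounded.mul_holds (IsPBounded.const 3) (IsPBounded.mul_holds h1 h1))

/-- The permanent of the `0 × 0` generic matrix is `1`. [folklore] -/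
theorem perPoly_fin_zero (K : Type*) [Field K] : perPoly (Fin 0) K = MvPolynomial.C 1 := by
  rw [perPoly, Matrix.permanent]
  simp

end DeRugyAltherre

open DeRugyAltherre in
/-- **Discharge of `DeRugyAltherre2013_thm1`** (de Rugy-Altherre 2013, Theorem 1, `VP`-closure
form): for rational `t ∉ {0, 1}` and a field `K` of characteristic zero, if the fermionic pencil
family `(Ferm^t_n)_n` is in `VP` then so is the permanent family. Proof: `per_n` is the nonzero
scalar multiple `κ⁻¹` of the projection `φsub` of `Ferm^t_{N(n)}`, `N(n) = O(n⁴)`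
(`perPoly_eq_smul_aeval`: two iff-coupled copies of the averaging graph of the generic matrix,
`cycW_gadget`, `cycW_MA`, `cycW_MB`, `aeval_fermionicPencil_eq_cycW`); projections are free and a
scalar costs one gate, so `L(per_n) ≤ L(Ferm^t_{N(n)}) + 1` is p-bounded.
[cite: DeRugyAltherre2013, Thm. 1 (§3), Lemmas 1–2 and Appendix A] -/
theorem DeRugyAltherre2013_thm1_holds : DeRugyAltherre2013_thm1 := by
  intro K _ _ t ht0 ht1 hVP
  refine ⟨?_, ?_⟩
  · have h := isPFamily_genMatrixPoly (R := K) (fun m => (1 : Equiv.Perm (Fin m) → K))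
    simp only [genMatrixPoly_one] at h
    exact h
  · have hb : IsPBounded fun n => complexity (fermionicPencil (Fin (Nsize n)) K (t : K)) + 1 :=
      IsPBounded.add_holds (IsPBounded.comp_holds hVP.2 Nsize_isPBounded) (IsPBounded.const 1)
    refine hb.mono fun n => ?_
    dsimp only
    rcases Nat.eq_zero_or_pos n with rfl | hn
    · rw [perPoly_fin_zero, complexity_C_holds]
      exact Nat.zero_le _
    · haveI : NeZero n := ⟨hn.ne'⟩
      exact complexity_perPoly_le K n t ht0 ht1

end Literature.Computability.AlgebraicComplexity
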